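import Literature.Computability.Complexity.EquivalenceProblemsSelector
import Literature.Computability.Complexity.EquivalenceProblemsHalving
import Literature.Computability.Complexity.HashBricks
import Literature.Computability.Complexity.AdaptiveQueries
import Literature.Computability.Complexity.KarpLipton
import Literature.Computability.Complexity.CoinCounting
import HarnessLib

/-!
# `CF = Ker ⟹ PH = ZPP^NP` (Fortnow–Grochow 2011, Cor. 3.4): the `NP` oracle, the adaptive `P^NP` machine, and the discharge of `blassGurevich_CF_eq_Ker_PH`

Third and last file of the proof of the named fact
`Literature.Computability.Complexity.blassGurevich_CF_eq_Ker_PH` of `EquivalenceProblems.lean` —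
Fortnow–Grochow 2011 (= arXiv:0907.4775), Cor. 3.4: "If `CF = Ker` then `PH = ZPP^NP`", rendered as
`KerFP ⊆ CFFP → PH ⊆ rp (P^NP) ∩ co (rp (P^NP))` — after `EquivalenceProblemsSelector.lean` (part I:
canonical witnesses from `Ker(FP) ⊆ CF(FP)`, FG Thm. 4.1 = the core of Blass–Gurevich II Thm. 3; the
selector, tournament and advice of Hemaspaandra–Naik–Ogihara–Selman 1996) and
`EquivalenceProblemsHalving.lean` (part II: the randomized halving of the bad set by affine hashing,
which replaces the learning step of Köbler–Watanabe 1998 in the printed chain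
BG II Thm. 3 → HNOS → KW). This file has three parts.

## Part III — the `NP` oracle of the advice construction

The randomized `P^NP` machine asks one `NP` language `CFKer.orc` three kinds of questions about the
current advice `K` (a string `Kbits` cut into blocks of the fixed length `LB(|x|)`, each block
`⟨⟨a, wa⟩, junk⟩` carrying an entry `⟨a, wa⟩`, instance `a = ⟨x, u⟩` and its witness `wa`):

* *search* (`mode = 0`, level `k`, prefix `pre`): is there a string `z` of length `LB(|x|)`
  extending `pre` whose entry is a valid member `a = ⟨x, u⟩`, `|u| ≤ p₁(|x|)`, passing the
  certificate of `K` (part I: every valid entry of `K` has key `≠ a` and beats `a`) and with `u`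
  hashed to zero at level `k` by the coins `c` (`Stockmeyer.HashesToZero c (p₁|x|+1) k (u·1)`, the
  bit-level test of part II's embedding; `u·1` is part II's `CFKer.mark u`)? — the prefix search over
  these `z` returns a bad element hashed to zero;
* *bad test* (`mode = 0`, `k = 0`, `pre = ε`): is the bad set of `K` nonempty?
* *decision* (`mode = 1`, `k = 0`, `pre = ε`): is there `u`, `|u| ≤ p₁(|x|)`, with `⟨x, u⟩`
  passing the certificate of `K`? — for a good `K` this is `∃ u, ⟨x, u⟩ ∉ N`, the `Σ₂` question.

All three are instances of one verifier `CFKer.ver ∈ P` (`ver_mem_P`) on `⟨q, z⟩`,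
`q = ⟨[mode], ⟨x, ⟨Kbits, ⟨c, ⟨1ᵏ, pre⟩⟩⟩⟩⟩` (`CFKer.mkQ`), assembled from the tree's brick algebra
(`Brick`, `Plumb`, `HashBricks`: projections, `takeFn`/`dropFn`, unary products, `𝔽₂` inner products,
bounded quantifiers `ballLang`) with no new machine; `CFKer.orc = ∃·ver ∈ NP` (`orc_mem_NP`). The
semantics are `mem_ver_iff` / `mem_orc_iff` (`CFKer.VerCond`), in terms of part I's `CFKer.Cert`
applied to the entries `entriesOf L Kbits` of the full blocks of `Kbits`.

## Part IV — the adaptive `P^NP` machine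

The construction is run by a **bounded adaptive reduction** (`AdaptiveQueries.lean`: a query generator
`Q ∈ FP` reading the input and the answer bits so far, a polynomial round budget, an evaluator
`D ∈ P`; `AdQuery.adLang_mem_PRel`) to `orc`, on inputs `w = ⟨x, y⟩` (`y` the coins):

* the schedule (`CFKer.qgen`, `qgen_apply`): query number `i = j·LR + k·LB + s` (`j < T` the round,
  `k < NB` the level, `s < LB` the step) is the search query with advice bits the first `j·LR`
  answers, coins block `j` of `y`, level `k`, and required prefix "the last `s` answers, then `1`"
  — a prefix search, one per level and round, whose `LB` answers spell a string passing the verifier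
  whenever one exists (`CFKer.greedy`, `greedy_spec`); queries `NQ = T·LR` and `NQ + 1` are the bad
  test and the decision query on the final advice;
* the evaluators (`CFKer.dec b₁ b₂`, `mem_dec_iff`): accept iff answer `NQ` is `b₁` and answer
  `NQ + 1` is `b₂` (`(0, 1)`: "advice good and `∃ u ∉ N`"; `(0, 0)`: "advice good and `∀ u ∈ N`");
* the answer string `CFKer.AB` decomposes into rounds and blocks accordingly (`block_eq_greedy`,
  `AB_round`, `AB_final`), whence membership in the reduced language (`mem_adLang_dec_iff`).

## Part V — assembly

* the semantics of the oracle's three questions in terms of the **bad set**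
  `BdK K = {u : |u| ≤ p₁ n, ⟨x, u⟩ bad for the entries of K}` (`zs_sound`, `zs_complete`,
  `badQ_mem_iff`, `decQ_mem_iff`, `good_decision`);
* the hypotheses of the halving lemma `CFKer.round_sum_le` (part II) for the machine's round map
  (`hround`), hence `Pr_y[BdK (advice after T rounds) ≠ ∅] ≤ 1/2` (`prob_bad_le_half`, by part II's
  `uniformProb_nonempty_le_half`);
* what acceptance by the two evaluators means (`accept_iff`, `reject_iff`), so every `Σ₂ᵖ` language
  and its complement are in `rp (P^NP)` with zero error and success probability `≥ 1/2`
  (`SigmaP_two_subset_Z`);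
* `Π₂ᵖ ⊆ Σ₂ᵖ` under the hypothesis (guess a good advice — one exists since the construction succeeds
  with positive probability; the matrix "bad test fails and decision query fails" is `coNP`;
  `PiP_two_subset_SigmaP_two'`), the collapse `PH = Σ₂ᵖ`
  (`KarpLipton.PH_eq_SigmaP_two_of_PiP_two_subset`), and **`blassGurevich_CF_eq_Ker_PH_holds`**.

All polynomial-time claims are compositions of existing bricks (`Plumb.divModFn`, `umulFn`, `takeFn`,
`dropFn`, `polyFn`, `bitAtFn`, `condFn`, `andParityFn`, `ballLang`); no machine is programmed.

## References

* L. Fortnow, J. A. Grochow, *Complexity classes of equivalence problems revisited*, Inform. and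
  Comput. 209 (2011) 748–763 = arXiv:0907.4775, Cor. 3.4 and Thm. 4.1 [FortnowGrochow2011].
* A. Blass, Y. Gurevich, *Equivalence relations, invariants, and normal forms II*, LNCS 171 (1984)
  24–42, Thm. 3.
* L. A. Hemaspaandra, A. V. Naik, M. Ogihara, A. L. Selman, *Computing solutions uniquely collapses
  the polynomial hierarchy*, SIAM J. Comput. 25 (1996) 697–708, Thm. 1 and its proof.
* J. Köbler, O. Watanabe, *New collapse consequences of NP having small circuits*, SIAM J. Comput.
  28 (1998) 311–324 (the `ZPP^NP` computation of correct advice, here for the HNOS advice).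
* R. E. Ladner, N. A. Lynch, A. L. Selman, *A comparison of polynomial time reducibilities*,
  Theoret. Comput. Sci. 1 (1975) 103–123, §2 (adaptive polynomial-time Turing reductions).
* S. Arora, B. Barak, *Computational Complexity: A Modern Approach*, CUP 2009, §1.3, Def. 2.1,
  Thm. 2.18 (prefix search with an `NP` oracle), §3.4, Thm. 5.4, §5.5, Def. 7.6.
-/

/-! # Part III: the `NP` oracle -/

namespace Literature.Computability.Complexity

open _root_.Computability Polynomial Brick Plumb OracleCompose HashBricks Stockmeyer TTClosure

namespace CFKer

/-! ### Blocks and entries of an advice string -/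

/-- The full blocks of length `L` of a string (a trailing partial block is ignored). [folklore] -/
def blocksOf (L : ℕ) (w : List Bool) : List (List Bool) :=
  (List.range (w.length / L)).map fun t => (w.drop (t * L)).take L

/-- The entries `fst b` of the full blocks `b`. [folklore] -/
def entriesOf (L : ℕ) (w : List Bool) : List (List Bool) :=
  (blocksOf L w).map fstF

/-- Membership in `blocksOf`. [folklore] -/
theorem mem_blocksOf_iff {L : ℕ} (hL : 0 < L) {w b : List Bool} :
    b ∈ blocksOf L w ↔ ∃ t, (t + 1) * L ≤ w.length ∧ b = (w.drop (t * L)).take L := by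
  unfold blocksOf
  rw [List.mem_map]
  constructor
  · rintro ⟨t, ht, rfl⟩
    rw [List.mem_range, Nat.lt_div_iff_mul_lt hL] at ht
    exact ⟨t, by rw [Nat.succ_mul]; omega, rfl⟩
  · rintro ⟨t, ht, rfl⟩
    refine ⟨t, ?_, rfl⟩
    rw [List.mem_range, Nat.lt_div_iff_mul_lt hL]
    rw [Nat.succ_mul] at ht
    omega

/-- A full block has length `L`. [folklore] -/
theorem length_of_mem_blocksOf {L : ℕ} (hL : 0 < L) {w b : List Bool} (hb : b ∈ blocksOf L w) :
    b.length = L := by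
  obtain ⟨t, ht, rfl⟩ := (mem_blocksOf_iff hL).1 hb
  rw [List.length_take, List.length_drop]
  rw [Nat.succ_mul] at ht
  omega

/-- Blocks of a concatenation of full blocks. [folklore] -/
theorem blocksOf_append {L : ℕ} (hL : 0 < L) {w v : List Bool} (hw : w.length % L = 0) :
    blocksOf L (w ++ v) = blocksOf L w ++ blocksOf L v := by
  obtain ⟨a, ha⟩ : ∃ a, w.length = a * L := ⟨w.length / L, by
    have := Nat.div_add_mod w.length L; rw [hw] at this; rw [mul_comm]; omega⟩
  unfold blocksOf
  have hdiv : (w ++ v).length / L = a + v.length / L := by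
    rw [List.length_append, ha, add_comm (a * L), Nat.add_mul_div_right _ _ hL, add_comm]
  rw [hdiv, List.range_add, List.map_append, List.map_map, ha, Nat.mul_div_cancel _ hL]
  congr 1
  · refine List.map_congr_left fun t ht => ?_
    rw [List.mem_range] at ht
    have h1 : t * L + L ≤ w.length := by rw [ha, ← Nat.succ_mul]; exact Nat.mul_le_mul_right L ht
    rw [List.drop_append_of_le_length (by omega), List.take_append_of_le_length (by rw [List.length_drop]; omega)]
  · refine List.map_congr_left fun t _ => ?_
    simp only [Function.comp_apply]
    rw [show (a + t) * L = w.length + t * L by rw [ha]; ring, List.drop_append,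
      List.drop_eq_nil_of_le (by omega), List.nil_append, Nat.add_sub_cancel_left]

/-- A single full block. [folklore] -/
theorem blocksOf_self {L : ℕ} (hL : 0 < L) {b : List Bool} (hb : b.length = L) : blocksOf L b = [b] := by
  unfold blocksOf
  rw [hb, Nat.div_self hL]
  simp [hb.symm]

/-- Entries of a concatenation of full blocks. [folklore] -/
theorem entriesOf_append {L : ℕ} (hL : 0 < L) {w v : List Bool} (hw : w.length % L = 0) :
    entriesOf L (w ++ v) = entriesOf L w ++ entriesOf L v := by
  rw [entriesOf, blocksOf_append hL hw, List.map_append]; rfl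

/-- The entry of a single full block. [folklore] -/
theorem entriesOf_self {L : ℕ} (hL : 0 < L) {b : List Bool} (hb : b.length = L) : entriesOf L b = [fstF b] := by
  rw [entriesOf, blocksOf_self hL hb, List.map_singleton]

/-- The empty advice has no entries. [folklore] -/
@[simp] theorem entriesOf_nil (L : ℕ) : entriesOf L [] = [] := by
  simp [entriesOf, blocksOf]

/-- Membership in a union of languages. [folklore] -/
private theorem memL_sup {L₁ L₂ : Language Bool} {w : List Bool} : w ∈ L₁ ⊔ L₂ ↔ w ∈ L₁ ∨ w ∈ L₂ := Iff.rfl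

/-- Membership in an intersection of languages. [folklore] -/
private theorem memL_inf {L₁ L₂ : Language Bool} {w : List Bool} : w ∈ L₁ ⊓ L₂ ↔ w ∈ L₁ ∧ w ∈ L₂ := Iff.rfl

/-- Membership in a complement language. [folklore] -/
private theorem memL_compl {L₁ : Language Bool} {w : List Bool} : w ∈ L₁ᶜ ↔ w ∉ L₁ := Iff.rfl

/-- Membership in a `setOf` language. [folklore] -/
private theorem memL_setOf {p : List Bool → Prop} {w : List Bool} :
    @Membership.mem (List Bool) (Language Bool) _ {v | p v} w ↔ p w :=
  Iff.rfl

/-! ### The query format -/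

/-- **The query** `⟨[mode], ⟨x, ⟨Kbits, ⟨c, ⟨1ᵏ, pre⟩⟩⟩⟩⟩`: mode bit, instance, advice bits, coins of the
round, level, required prefix. [folklore] -/
def mkQ (mode : Bool) (x Kbits c : List Bool) (k : ℕ) (pre : List Bool) : List Bool :=
  boolPair [mode] (boolPair x (boolPair Kbits (boolPair c (boolPair (ones k) pre))))

/-- The block-length polynomial `LB = 2 (2 (2X + 2 + p₁) + 2 + p₂ ∘ (2X + 2 + p₁)) + 2`: room for
`⟨⟨⟨x, u⟩, wa⟩, junk⟩` with `|u| ≤ p₁ |x|`, `|wa| ≤ p₂ |⟨x, u⟩|`. [folklore] -/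
noncomputable def LB (p₁ p₂ : Polynomial ℕ) : Polynomial ℕ :=
  2 * (2 * (2 * X + 2 + p₁) + 2 + p₂.comp (2 * X + 2 + p₁)) + 2

/-- `LB ≥ 2`. [folklore] -/
theorem two_le_LB (p₁ p₂ : Polynomial ℕ) (n : ℕ) : 2 ≤ (LB p₁ p₂).eval n := by
  simp [LB]

/-- `LB` is monotone. [folklore] -/
theorem LB_mono (p₁ p₂ : Polynomial ℕ) {a b : ℕ} (h : a ≤ b) : (LB p₁ p₂).eval a ≤ (LB p₁ p₂).eval b :=
  TM2Iter.eval_mono _ h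

/-! ### Parsers of the verifier input `v = ⟨q, z⟩` -/

section Parsers

/-- The mode `[mode]`. [folklore] -/
def modeV : List Bool → List Bool := fstF ∘ fstF
/-- The instance `x`. [folklore] -/
def xV : List Bool → List Bool := nthF 1 ∘ fstF
/-- The advice bits. [folklore] -/
def KV : List Bool → List Bool := nthF 2 ∘ fstF
/-- The coins. [folklore] -/
def cV : List Bool → List Bool := nthF 3 ∘ fstF
/-- The level `1ᵏ`. [folklore] -/
def lvV : List Bool → List Bool := nthF 4 ∘ fstF
/-- The required prefix. [folklore] -/
def preV : List Bool → List Bool := sndPow 4 ∘ fstF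
/-- The searched string `z`. [folklore] -/
def zV : List Bool → List Bool := sndF
/-- Its entry `e = fst z`. [folklore] -/
def eV : List Bool → List Bool := fstF ∘ sndF
/-- The instance `a = fst e`. [folklore] -/
def aV : List Bool → List Bool := fstF ∘ eV
/-- The witness `wa = snd e`. [folklore] -/
def waV : List Bool → List Bool := sndF ∘ eV
/-- The element `u = snd a`. [folklore] -/
def uV : List Bool → List Bool := sndF ∘ aV
/-- The marked element `u·1`. [folklore] -/
def muV : List Bool → List Bool := fun v => uV v ++ [true]

/-- The parsers are in `FP`. [folklore] -/
theorem parsers_mem_FP :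
    modeV ∈ FP ∧ xV ∈ FP ∧ KV ∈ FP ∧ cV ∈ FP ∧ lvV ∈ FP ∧ preV ∈ FP ∧ zV ∈ FP ∧ eV ∈ FP ∧ aV ∈ FP ∧
      waV ∈ FP ∧ uV ∈ FP ∧ muV ∈ FP := by
  have he : eV ∈ FP := comp_mem_FP fstF_mem_FP sndF_mem_FP
  have ha : aV ∈ FP := comp_mem_FP fstF_mem_FP he
  have hu : uV ∈ FP := comp_mem_FP sndF_mem_FP ha
  exact ⟨comp_mem_FP fstF_mem_FP fstF_mem_FP, comp_mem_FP (nthF_mem_FP 1) fstF_mem_FP,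
    comp_mem_FP (nthF_mem_FP 2) fstF_mem_FP, comp_mem_FP (nthF_mem_FP 3) fstF_mem_FP,
    comp_mem_FP (nthF_mem_FP 4) fstF_mem_FP, comp_mem_FP (sndPow_mem_FP 4) fstF_mem_FP, sndF_mem_FP, he, ha,
    comp_mem_FP sndF_mem_FP he, hu, append_mem_FP hu (const_mem_FP [true])⟩

variable (mode : Bool) (x Kbits c : List Bool) (k : ℕ) (pre z : List Bool)

/-- **Parsing a verifier input.** [folklore] -/
theorem parse_mkQ :
    modeV (boolPair (mkQ mode x Kbits c k pre) z) = [mode] ∧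
    xV (boolPair (mkQ mode x Kbits c k pre) z) = x ∧
    KV (boolPair (mkQ mode x Kbits c k pre) z) = Kbits ∧
    cV (boolPair (mkQ mode x Kbits c k pre) z) = c ∧
    lvV (boolPair (mkQ mode x Kbits c k pre) z) = ones k ∧
    preV (boolPair (mkQ mode x Kbits c k pre) z) = pre ∧
    zV (boolPair (mkQ mode x Kbits c k pre) z) = z ∧
    eV (boolPair (mkQ mode x Kbits c k pre) z) = fstF z ∧
    aV (boolPair (mkQ mode x Kbits c k pre) z) = fstF (fstF z) ∧
    waV (boolPair (mkQ mode x Kbits c k pre) z) = sndF (fstF z) ∧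
    uV (boolPair (mkQ mode x Kbits c k pre) z) = sndF (fstF (fstF z)) ∧
    muV (boolPair (mkQ mode x Kbits c k pre) z) = sndF (fstF (fstF z)) ++ [true] := by
  simp [mkQ, modeV, xV, KV, cV, lvV, preV, zV, eV, aV, waV, uV, muV, nthF, sndPow]

end Parsers

/-! ### The hash test: `u·1` hashes to zero at level `k` under the coins `c` -/

section HashTest

variable (p₁ : Polynomial ℕ)

/-- `1^{j'(M+1)}` with `M = p₁|x| + 1`: the offset of hash row `j'` in the coins, on `b = ⟨v, 1^{j'}⟩`.
[folklore] -/
noncomputable def offH : List Bool → List Bool := umulFn ∘ fanoutFn sndF (polyFn (p₁ + 2) ∘ xV ∘ fstF)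
/-- The coins from row `j'` on. [folklore] -/
noncomputable def rowH : List Bool → List Bool := dropFn ∘ fanoutFn (offH p₁) (cV ∘ fstF)
/-- The inner-product bit of row `j'` with `u·1`. [folklore] -/
noncomputable def dotH : List Bool → List Bool := andParityFn ∘ fanoutFn (rowH p₁) (muV ∘ fstF)
/-- The offset bit of row `j'`. [folklore] -/
noncomputable def offBitH : List Bool → List Bool :=
  headBitFn ∘ dropFn ∘ fanoutFn (concatFn ∘ fanoutFn (offH p₁) (polyFn (p₁ + 1) ∘ xV ∘ fstF)) (cV ∘ fstF)

/-- **The row language**: `|1ᵏ| ≤ j'`, or row `j'` hashes `u·1` to `0`. [folklore] -/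
noncomputable def rowL : Language Bool :=
  (fanoutFn sndF (lvV ∘ fstF) ⁻¹' LenLe X) ⊔ {b | dotH p₁ b = offBitH p₁ b}

/-- `rowL ∈ P`. [folklore] -/
theorem rowL_mem_P : rowL p₁ ∈ Classes.P := by
  obtain ⟨-, hx, -, hc, hlv, -, -, -, -, -, -, hmu⟩ := parsers_mem_FP
  have hoff : offH p₁ ∈ FP := comp_mem_FP umulFn_mem_FP (fanoutFn_mem_FP sndF_mem_FP
    (comp_mem_FP (polyFn_mem_FP _) (comp_mem_FP hx fstF_mem_FP)))
  have hrow : rowH p₁ ∈ FP := comp_mem_FP dropFn_mem_FP (fanoutFn_mem_FP hoff (comp_mem_FP hc fstF_mem_FP))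
  have hdot : dotH p₁ ∈ FP := comp_mem_FP andParityFn_mem_FP (fanoutFn_mem_FP hrow (comp_mem_FP hmu fstF_mem_FP))
  have hob : offBitH p₁ ∈ FP := comp_mem_FP headBitFn_mem_FP (comp_mem_FP dropFn_mem_FP (fanoutFn_mem_FP
    (comp_mem_FP concatFn_mem_FP (fanoutFn_mem_FP hoff (comp_mem_FP (polyFn_mem_FP _) (comp_mem_FP hx fstF_mem_FP))))
    (comp_mem_FP hc fstF_mem_FP)))
  exact union_mem_P (preimage_mem_P (LenLe_mem_P X) (fanoutFn_mem_FP sndF_mem_FP (comp_mem_FP hlv fstF_mem_FP)))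
    (setOf_apply_eq_apply_mem_P hdot hob)

/-- **The hash test** as a bounded quantifier over the rows. [folklore] -/
noncomputable def hashL : Language Bool := ballLang X (rowL p₁)

/-- `hashL ∈ P`. [folklore] -/
theorem hashL_mem_P : hashL p₁ ∈ Classes.P := ballLang_mem_P _ (rowL_mem_P p₁)

variable (mode : Bool) (x Kbits c : List Bool) (k : ℕ) (pre z : List Bool)

/-- The coins from position `n` start with bit `n`. [folklore] -/
private theorem headD_drop' (l : List Bool) (n : ℕ) : (l.drop n).headD false = coinBit l n := by
  rw [coinBit, List.getD_eq_getElem?_getD, List.headD_eq_head?_getD, List.head?_drop]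

/-- **Semantics of the row test.** [folklore] -/
theorem mem_rowL_iff (j' : ℕ) :
    boolPair (boolPair (mkQ mode x Kbits c k pre) z) (ones j') ∈ rowL p₁ ↔
      k ≤ j' ∨ rowParity c (p₁.eval x.length + 1) (sndF (fstF (fstF z)) ++ [true]) j' = false := by
  obtain ⟨-, hx, -, hc, hlv, -, -, -, -, -, -, hmu⟩ := parse_mkQ mode x Kbits c k pre z
  set v := boolPair (mkQ mode x Kbits c k pre) z
  set m := p₁.eval x.length + 1 with hm
  have hoff : offH p₁ (boolPair v (ones j')) = ones (j' * (m + 1)) := by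
    rw [offH, Function.comp_apply, fanoutFn_apply, sndF_boolPair, Function.comp_apply, Function.comp_apply,
      fstF_boolPair, hx, polyFn_apply, umulFn_boolPair]
    simp [hm, add_assoc]
  have hdot : dotH p₁ (boolPair v (ones j')) =
      [decide (Odd (((c.drop (j' * (m + 1))).zipWith (· && ·) (sndF (fstF (fstF z)) ++ [true])).count true))] := by
    rw [dotH, Function.comp_apply, fanoutFn_apply, rowH, Function.comp_apply, fanoutFn_apply, hoff,
      Function.comp_apply, fstF_boolPair, hc, dropFn_boolPair, Function.comp_apply, fstF_boolPair, hmu,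
      andParityFn_boolPair, List.length_replicate]
  have hob : offBitH p₁ (boolPair v (ones j')) = [coinBit c (j' * (m + 1) + m)] := by
    rw [offBitH, Function.comp_apply, Function.comp_apply, fanoutFn_apply, Function.comp_apply, fanoutFn_apply,
      hoff, Function.comp_apply, Function.comp_apply, fstF_boolPair, hx, polyFn_apply, concatFn_boolPair,
      Function.comp_apply, fstF_boolPair, hc, dropFn_boolPair, headBitFn_apply, headD_drop']
    simp [hm]
  rw [rowL, memL_sup, memL_preimage, fanoutFn_apply, sndF_boolPair, Function.comp_apply, fstF_boolPair, hlv,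
    boolPair_mem_LenLe, memL_setOf, hdot, hob, rowParity, rowStart]
  simp only [List.length_replicate, eval_X, List.cons.injEq, and_true]
  constructor
  · rintro (h | h)
    · exact Or.inl h
    · exact Or.inr (by rw [h]; simp)
  · rintro (h | h)
    · exact Or.inl h
    · refine Or.inr ?_
      revert h
      cases decide (Odd (List.count true (List.zipWith (fun x1 x2 => x1 && x2) (List.drop (j' * (m + 1)) c)
        (sndF (fstF (fstF z)) ++ [true])))) <;> cases coinBit c (j' * (m + 1) + m) <;> simp

/-- The verifier input is at least `k` long. [folklore] -/
theorem le_length_v : k ≤ (boolPair (mkQ mode x Kbits c k pre) z).length := by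
  simp only [mkQ, length_boolPair, List.length_replicate, List.length_singleton]; omega

/-- **Semantics of the hash test.** [folklore] -/
theorem mem_hashL_iff :
    boolPair (mkQ mode x Kbits c k pre) z ∈ hashL p₁ ↔
      HashesToZero c (p₁.eval x.length + 1) k (sndF (fstF (fstF z)) ++ [true]) := by
  have hk := le_length_v mode x Kbits c k pre z
  rw [hashL, mem_ballLang]
  simp only [eval_X]
  constructor
  · intro h i hi
    have := (mem_rowL_iff p₁ mode x Kbits c k pre z i).1 (h i (by omega))
    exact this.resolve_left (by omega)
  · intro h i _
    exact (mem_rowL_iff p₁ mode x Kbits c k pre z i).2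
      (if hki : k ≤ i then Or.inl hki else Or.inr (h i (by omega)))

end HashTest

/-! ### The advice test: every full block of `Kbits` passes the certificate against `a` -/

section AdviceTest

variable (p₁ p₂ : Polynomial ℕ) (Rp : Language Bool) (cw : List Bool → List Bool)

/-- `1^{t·LB(|x|)}`: the offset of block `t`, on `b = ⟨v, 1ᵗ⟩`. [folklore] -/
noncomputable def offB : List Bool → List Bool := umulFn ∘ fanoutFn sndF (polyFn (LB p₁ p₂) ∘ xV ∘ fstF)
/-- Block `t` of the advice bits: `(Kbits ⇂ t·LB) ↾ LB`. [folklore] -/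
noncomputable def blkB : List Bool → List Bool :=
  takeFn ∘ fanoutFn (polyFn (LB p₁ p₂) ∘ xV ∘ fstF) (dropFn ∘ fanoutFn (offB p₁ p₂) (KV ∘ fstF))
/-- Its entry `e_t = fst (block t)`. [folklore] -/
noncomputable def entB : List Bool → List Bool := fstF ∘ blkB p₁ p₂

/-- **The block language**: block `t` is not a full block, or its entry is invalid, or its entry has
key `≠ a` and beats `a`. [HNOS 1996, proof of Thm. 1 (checking the advice)] [folklore] -/
noncomputable def blockL : Language Bool :=
  (fanoutFn (xV ∘ fstF) (blkB p₁ p₂) ⁻¹' LenLt (LB p₁ p₂)) ⊔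
    ((fanoutFn (fstF ∘ entB p₁ p₂) (sndF ∘ entB p₁ p₂) ⁻¹' Rp)ᶜ ⊔
      ({b | (fstF ∘ entB p₁ p₂) b = (aV ∘ fstF) b}ᶜ ⊓ (fanoutFn (entB p₁ p₂) (aV ∘ fstF) ⁻¹' BeatsL cw)))

/-- `blockL ∈ P` (for `Rp ∈ P`, `cw ∈ FP`). [folklore] -/
theorem blockL_mem_P (hRp : Rp ∈ Classes.P) (hcw : cw ∈ FP) : blockL p₁ p₂ Rp cw ∈ Classes.P := by
  obtain ⟨-, hx, hK, -, -, -, -, -, ha, -, -, -⟩ := parsers_mem_FP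
  have hoff : offB p₁ p₂ ∈ FP := comp_mem_FP umulFn_mem_FP (fanoutFn_mem_FP sndF_mem_FP
    (comp_mem_FP (polyFn_mem_FP _) (comp_mem_FP hx fstF_mem_FP)))
  have hblk : blkB p₁ p₂ ∈ FP := comp_mem_FP takeFn_mem_FP (fanoutFn_mem_FP
    (comp_mem_FP (polyFn_mem_FP _) (comp_mem_FP hx fstF_mem_FP))
    (comp_mem_FP dropFn_mem_FP (fanoutFn_mem_FP hoff (comp_mem_FP hK fstF_mem_FP))))
  have hent : entB p₁ p₂ ∈ FP := comp_mem_FP fstF_mem_FP hblk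
  refine union_mem_P (preimage_mem_P (LenLt_mem_P _) (fanoutFn_mem_FP (comp_mem_FP hx fstF_mem_FP) hblk))
    (union_mem_P (compl_mem_P_iff.2 (preimage_mem_P hRp (fanoutFn_mem_FP (comp_mem_FP fstF_mem_FP hent)
      (comp_mem_FP sndF_mem_FP hent))))
      (inter_mem_P (compl_mem_P_iff.2 (setOf_apply_eq_apply_mem_P (comp_mem_FP fstF_mem_FP hent)
        (comp_mem_FP ha fstF_mem_FP))) (preimage_mem_P (BeatsL_mem_P hcw) (fanoutFn_mem_FP hent
          (comp_mem_FP ha fstF_mem_FP)))))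

/-- **The advice test** as a bounded quantifier over the block indices `t < |v|`. [folklore] -/
noncomputable def adviceL : Language Bool := ballLang X (blockL p₁ p₂ Rp cw)

/-- `adviceL ∈ P`. [folklore] -/
theorem adviceL_mem_P (hRp : Rp ∈ Classes.P) (hcw : cw ∈ FP) : adviceL p₁ p₂ Rp cw ∈ Classes.P :=
  ballLang_mem_P _ (blockL_mem_P p₁ p₂ Rp cw hRp hcw)

variable (mode : Bool) (x Kbits c : List Bool) (k : ℕ) (pre z : List Bool)

/-- **Semantics of the block test.** [folklore] -/
theorem mem_blockL_iff (t : ℕ) :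
    boolPair (boolPair (mkQ mode x Kbits c k pre) z) (ones t) ∈ blockL p₁ p₂ Rp cw ↔
      ((Kbits.drop (t * (LB p₁ p₂).eval x.length)).take ((LB p₁ p₂).eval x.length)).length <
          (LB p₁ p₂).eval x.length ∨
        (¬ ValidE Rp (fstF ((Kbits.drop (t * (LB p₁ p₂).eval x.length)).take ((LB p₁ p₂).eval x.length))) ∨
          (fstP (fstF ((Kbits.drop (t * (LB p₁ p₂).eval x.length)).take ((LB p₁ p₂).eval x.length))) ≠
              fstF (fstF z) ∧
            beats cw (fstP (fstF ((Kbits.drop (t * (LB p₁ p₂).eval x.length)).take ((LB p₁ p₂).eval x.length))))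
              (sndP (fstF ((Kbits.drop (t * (LB p₁ p₂).eval x.length)).take ((LB p₁ p₂).eval x.length))))
              (fstF (fstF z)))) := by
  obtain ⟨-, hx, hK, -, -, -, -, -, ha, -, -, -⟩ := parse_mkQ mode x Kbits c k pre z
  set v := boolPair (mkQ mode x Kbits c k pre) z
  set L := (LB p₁ p₂).eval x.length with hL
  have hoff : offB p₁ p₂ (boolPair v (ones t)) = ones (t * L) := by
    rw [offB, Function.comp_apply, fanoutFn_apply, sndF_boolPair, Function.comp_apply, Function.comp_apply,
      fstF_boolPair, hx, polyFn_apply, umulFn_boolPair]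
  have hblk : blkB p₁ p₂ (boolPair v (ones t)) = (Kbits.drop (t * L)).take L := by
    rw [blkB, Function.comp_apply, fanoutFn_apply, Function.comp_apply, Function.comp_apply, fstF_boolPair, hx,
      polyFn_apply, Function.comp_apply, fanoutFn_apply, hoff, Function.comp_apply, fstF_boolPair, hK,
      dropFn_boolPair, takeFn_boolPair, List.length_replicate, List.length_replicate]
  have hent : entB p₁ p₂ (boolPair v (ones t)) = fstF ((Kbits.drop (t * L)).take L) := by
    rw [entB, Function.comp_apply, hblk]
  rw [blockL, memL_sup, memL_sup, memL_inf, memL_compl, memL_compl, memL_preimage, memL_preimage, memL_preimage,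
    memL_setOf]
  simp only [fanoutFn_apply, Function.comp_apply, fstF_boolPair, hx, hblk, boolPair_mem_LenLt, hent, ha,
    boolPair_mem_BeatsL]
  rfl

/-- Block index `t` of a full block is below `|v|`. [folklore] -/
theorem lt_length_v_of_block {t : ℕ} (ht : (t + 1) * (LB p₁ p₂).eval x.length ≤ Kbits.length) :
    t < (boolPair (mkQ mode x Kbits c k pre) z).length := by
  have h2 := two_le_LB p₁ p₂ x.length
  simp only [mkQ, length_boolPair]
  rw [Nat.succ_mul] at ht
  nlinarith

/-- **Semantics of the advice test**: the certificate of part I for the entries of the full blocks.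
[HNOS 1996, proof of Thm. 1] [folklore] -/
theorem mem_adviceL_iff :
    boolPair (mkQ mode x Kbits c k pre) z ∈ adviceL p₁ p₂ Rp cw ↔
      Cert Rp cw (entriesOf ((LB p₁ p₂).eval x.length) Kbits) (fstF (fstF z)) := by
  set L := (LB p₁ p₂).eval x.length with hL
  have hLpos : 0 < L := lt_of_lt_of_le (by norm_num) (two_le_LB p₁ p₂ x.length)
  rw [adviceL, mem_ballLang, Cert]
  simp only [eval_X]
  constructor
  · intro h e he hv
    rw [entriesOf, List.mem_map] at he
    obtain ⟨b, hb, rfl⟩ := he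
    obtain ⟨t, ht, rfl⟩ := (mem_blocksOf_iff hLpos).1 hb
    have hfull : ((Kbits.drop (t * L)).take L).length = L := by
      rw [List.length_take, List.length_drop]; rw [Nat.succ_mul] at ht; omega
    rcases (mem_blockL_iff p₁ p₂ Rp cw mode x Kbits c k pre z t).1
      (h t (lt_length_v_of_block p₁ p₂ mode x Kbits c k pre z ht)) with h1 | h1 | h1
    · rw [hfull] at h1; exact (lt_irrefl _ h1).elim
    · exact (h1 hv).elim
    · exact h1
  · intro h t _
    rw [mem_blockL_iff]
    by_cases hfull : ((Kbits.drop (t * L)).take L).length < L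
    · exact Or.inl hfull
    · right
      have hlen : ((Kbits.drop (t * L)).take L).length = L := by
        have := List.length_take_le L (Kbits.drop (t * L)); omega
      have ht : (t + 1) * L ≤ Kbits.length := by
        rw [List.length_take, List.length_drop] at hlen; rw [Nat.succ_mul]; omega
      have hmem : fstF ((Kbits.drop (t * L)).take L) ∈ entriesOf L Kbits := by
        rw [entriesOf, List.mem_map]
        exact ⟨_, (mem_blocksOf_iff hLpos).2 ⟨t, ht, rfl⟩, rfl⟩
      by_cases hv : ValidE Rp (fstF ((Kbits.drop (t * L)).take L))
      · exact Or.inr (h _ hmem hv)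
      · exact Or.inl hv

end AdviceTest

/-! ### The verifier and the oracle -/

section Verifier

variable (p₁ p₂ : Polynomial ℕ) (Rp : Language Bool) (cw : List Bool → List Bool)

/-- **The verifier** `ver` on `v = ⟨q, z⟩`: `pre ⊑ z`, `|z| = LB(|x|)`, `a = ⟨x, u⟩`, `|u| ≤ p₁(|x|)`,
(`mode = 1` or `⟨a, wa⟩ ∈ Rp`), `u·1` hashes to zero at level `k`, and the advice test.
[HNOS 1996, proof of Thm. 1; Arora–Barak 2009, Def. 2.1] [folklore] -/
noncomputable def ver : Language Bool :=
  {v | (takeFn ∘ fanoutFn preV zV) v = preV v} ⊓ (fanoutFn xV zV ⁻¹' LenEq (LB p₁ p₂)) ⊓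
    {v | aV v = (fanoutFn xV uV) v} ⊓ (fanoutFn xV uV ⁻¹' LenLe p₁) ⊓
    ({v | modeV v = (fun _ => [true]) v} ⊔ (fanoutFn aV waV ⁻¹' Rp)) ⊓ hashL p₁ ⊓ adviceL p₁ p₂ Rp cw

/-- **`ver ∈ P`.** [folklore] -/
theorem ver_mem_P (hRp : Rp ∈ Classes.P) (hcw : cw ∈ FP) : ver p₁ p₂ Rp cw ∈ Classes.P := by
  obtain ⟨hmode, hx, -, -, -, hpre, hz, -, ha, hwa, hu, -⟩ := parsers_mem_FP
  refine inter_mem_P (inter_mem_P (inter_mem_P (inter_mem_P (inter_mem_P (inter_mem_P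
    (setOf_apply_eq_apply_mem_P (comp_mem_FP takeFn_mem_FP (fanoutFn_mem_FP hpre hz)) hpre)
    (preimage_mem_P (LenEq_mem_P _) (fanoutFn_mem_FP hx hz)))
    (setOf_apply_eq_apply_mem_P ha (fanoutFn_mem_FP hx hu)))
    (preimage_mem_P (LenLe_mem_P _) (fanoutFn_mem_FP hx hu)))
    (union_mem_P (setOf_apply_eq_apply_mem_P hmode (const_mem_FP _)) (preimage_mem_P hRp (fanoutFn_mem_FP ha hwa))))
    (hashL_mem_P p₁)) (adviceL_mem_P p₁ p₂ Rp cw hRp hcw)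

/-- **The oracle** `orc = ∃·ver`: `q ∈ orc` iff some `z` of length `≤ LB(|q|)` passes the verifier.
[Arora–Barak 2009, Def. 2.1] [folklore] -/
def orc : Language Bool :=
  {q | ∃ z : List Bool, z.length ≤ (LB p₁ p₂).eval q.length ∧ boolPair q z ∈ ver p₁ p₂ Rp cw}

/-- **`orc ∈ NP`.** [folklore] -/
theorem orc_mem_NP (hRp : Rp ∈ Classes.P) (hcw : cw ∈ FP) : orc p₁ p₂ Rp cw ∈ Nondeterministic.NP :=
  ⟨ver p₁ p₂ Rp cw, ver_mem_P p₁ p₂ Rp cw hRp hcw, LB p₁ p₂, fun _ => Iff.rfl⟩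

variable (mode : Bool) (x Kbits c : List Bool) (k : ℕ) (pre z : List Bool)

/-- **The conditions checked by the verifier**, on the entry `e = fst z = ⟨a, wa⟩`, `u = snd a`
(a predicate of the query data and `z`; all parameters explicit). [folklore] -/
def VerCond (p₁ p₂ : Polynomial ℕ) (Rp : Language Bool) (cw : List Bool → List Bool) (mode : Bool)
    (x Kbits c : List Bool) (k : ℕ) (pre z : List Bool) : Prop :=
  pre <+: z ∧ z.length = (LB p₁ p₂).eval x.length ∧
    fstF (fstF z) = boolPair x (sndF (fstF (fstF z))) ∧ (sndF (fstF (fstF z))).length ≤ p₁.eval x.length ∧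
    (mode = true ∨ boolPair (fstF (fstF z)) (sndF (fstF z)) ∈ Rp) ∧
    HashesToZero c (p₁.eval x.length + 1) k (sndF (fstF (fstF z)) ++ [true]) ∧
    Cert Rp cw (entriesOf ((LB p₁ p₂).eval x.length) Kbits) (fstF (fstF z))

/-- **Semantics of the verifier.** [folklore] -/
theorem mem_ver_iff :
    boolPair (mkQ mode x Kbits c k pre) z ∈ ver p₁ p₂ Rp cw ↔ VerCond p₁ p₂ Rp cw mode x Kbits c k pre z := by
  obtain ⟨hmode, hx, -, -, -, hpre, hz, -, ha, hwa, hu, -⟩ := parse_mkQ mode x Kbits c k pre z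
  have hh := mem_hashL_iff p₁ mode x Kbits c k pre z
  have hadv := mem_adviceL_iff p₁ p₂ Rp cw mode x Kbits c k pre z
  set v := boolPair (mkQ mode x Kbits c k pre) z
  rw [ver, memL_inf, memL_inf, memL_inf, memL_inf, memL_inf, memL_inf, memL_sup, memL_setOf, memL_setOf, memL_setOf,
    memL_preimage, memL_preimage, memL_preimage, Function.comp_apply, fanoutFn_apply, hpre, hz, takeFn_boolPair,
    fanoutFn_apply, hx, hz, boolPair_mem_LenEq, ha, fanoutFn_apply, hx, hu, boolPair_mem_LenLe, hmode,
    fanoutFn_apply, ha, hwa, hh, hadv, VerCond, List.prefix_iff_eq_take]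
  simp only [List.cons.injEq, and_true, and_assoc]
  constructor
  · rintro ⟨h1, h2, h3, h4, h5, h6, h7⟩
    exact ⟨h1.symm, h2, h3, h4, h5.imp_left (fun h => by simpa using h.symm), h6, h7⟩
  · rintro ⟨h1, h2, h3, h4, h5, h6, h7⟩
    exact ⟨h1.symm, h2, h3, h4, h5.imp_left (fun h => by simp [h]), h6, h7⟩

/-- The query is at least as long as the instance. [folklore] -/
theorem length_le_length_mkQ : x.length ≤ (mkQ mode x Kbits c k pre).length := by
  simp only [mkQ, length_boolPair]; omega

/-- **Semantics of the oracle.** [folklore] -/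
theorem mem_orc_iff :
    mkQ mode x Kbits c k pre ∈ orc p₁ p₂ Rp cw ↔ ∃ z, VerCond p₁ p₂ Rp cw mode x Kbits c k pre z := by
  constructor
  · rintro ⟨z, -, hz⟩
    exact ⟨z, (mem_ver_iff p₁ p₂ Rp cw mode x Kbits c k pre z).1 hz⟩
  · rintro ⟨z, hz⟩
    refine ⟨z, ?_, (mem_ver_iff p₁ p₂ Rp cw mode x Kbits c k pre z).2 hz⟩
    rw [hz.2.1]
    exact LB_mono p₁ p₂ (length_le_length_mkQ mode x Kbits c k pre)

end Verifier

end CFKer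

end Literature.Computability.Complexity

/-! # Part IV: the adaptive `P^NP` machine -/

namespace Literature.Computability.Complexity

open _root_.Computability Polynomial Brick Plumb OracleCompose HashBricks Stockmeyer TTClosure AdQuery

namespace CFKer

/-! ### The parameters, as polynomials in `n = |x|` -/

section Params

variable (p₁ p₂ : Polynomial ℕ)

/-- Number of levels `NB = p₁ + 4` (levels `0 … p₁ + 3`, hash dimension `p₁ + 1`). [folklore] -/
noncomputable def NBp : Polynomial ℕ := p₁ + 4
/-- Queries per round `LR = NB · LB`. [folklore] -/
noncomputable def LRp : Polynomial ℕ := NBp p₁ * LB p₁ p₂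
/-- Coins per round `ℓ = (p₁ + 3)(p₁ + 2)`. [folklore] -/
noncomputable def ellp : Polynomial ℕ := (p₁ + 3) * (p₁ + 2)
/-- Rounds `T = 8 (p₁ + 2)`. [folklore] -/
noncomputable def Tp : Polynomial ℕ := 8 * (p₁ + 2)
/-- Search queries `NQ = T · LR`. [folklore] -/
noncomputable def NQp : Polynomial ℕ := Tp p₁ * LRp p₁ p₂
/-- Coins `T · ℓ`. [folklore] -/
noncomputable def coinP : Polynomial ℕ := Tp p₁ * ellp p₁

variable (n : ℕ)

/-- Values of the parameters. [folklore] -/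
theorem eval_params :
    (NBp p₁).eval n = p₁.eval n + 4 ∧ (LRp p₁ p₂).eval n = (p₁.eval n + 4) * (LB p₁ p₂).eval n ∧
    (ellp p₁).eval n = (p₁.eval n + 3) * (p₁.eval n + 2) ∧ (Tp p₁).eval n = 8 * (p₁.eval n + 2) ∧
    (NQp p₁ p₂).eval n = 8 * (p₁.eval n + 2) * ((p₁.eval n + 4) * (LB p₁ p₂).eval n) ∧
    (coinP p₁).eval n = 8 * (p₁.eval n + 2) * ((p₁.eval n + 3) * (p₁.eval n + 2)) := by
  simp [NBp, LRp, ellp, Tp, NQp, coinP]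

end Params

/-! ### The query generator -/

section QGen

variable (p₁ p₂ : Polynomial ℕ)

/-- The instance `x` of `⟨⟨x, y⟩, bs⟩`. [folklore] -/
def xQ : List Bool → List Bool := fstF ∘ fstF
/-- The coins `y`. [folklore] -/
def yQ : List Bool → List Bool := sndF ∘ fstF
/-- The answers so far `bs`. [folklore] -/
def bsQ : List Bool → List Bool := sndF
/-- `⟨1ʲ, 1ʳ⟩ = divmod(|bs|, LR)`. [folklore] -/
noncomputable def jrQ : List Bool → List Bool := divModFn ∘ fanoutFn (polyFn (LRp p₁ p₂) ∘ xQ) (onesFn ∘ bsQ)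
/-- `⟨1ᵏ, 1ˢ⟩ = divmod(r, LB)`. [folklore] -/
noncomputable def ksQ : List Bool → List Bool := divModFn ∘ fanoutFn (polyFn (LB p₁ p₂) ∘ xQ) (sndF ∘ jrQ p₁ p₂)
/-- The advice bits: the first `j·LR` answers. [folklore] -/
noncomputable def KQ : List Bool → List Bool :=
  takeFn ∘ fanoutFn (umulFn ∘ fanoutFn (fstF ∘ jrQ p₁ p₂) (polyFn (LRp p₁ p₂) ∘ xQ)) bsQ
/-- The coins of round `j`: `(y ⇂ jℓ) ↾ ℓ`. [folklore] -/
noncomputable def cQ : List Bool → List Bool :=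
  takeFn ∘ fanoutFn (polyFn (ellp p₁) ∘ xQ)
    (dropFn ∘ fanoutFn (umulFn ∘ fanoutFn (fstF ∘ jrQ p₁ p₂) (polyFn (ellp p₁) ∘ xQ)) yQ)
/-- The last `s` answers, then `1`. [folklore] -/
noncomputable def lastQ : List Bool → List Bool :=
  fun z => (dropFn ∘ fanoutFn (dropFn ∘ fanoutFn (sndF ∘ ksQ p₁ p₂) (onesFn ∘ bsQ)) bsQ) z ++ [true]
/-- Still searching: `|bs| < NQ(|x|)`. [folklore] -/
noncomputable def Searching : Language Bool := fanoutFn xQ bsQ ⁻¹' LenLt (NQp p₁ p₂)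
/-- The decision query: `|bs| = NQ(|x|) + 1`. [folklore] -/
noncomputable def Deciding : Language Bool := fanoutFn xQ bsQ ⁻¹' LenEq (NQp p₁ p₂ + 1)
/-- The required prefix: `lastQ` while searching, `ε` afterwards. [folklore] -/
noncomputable def preQ : List Bool → List Bool := condFn (Searching p₁ p₂) (lastQ p₁ p₂) fun _ => []
/-- The mode: `[1]` for the decision query, `[0]` otherwise. [folklore] -/
noncomputable def modeQ : List Bool → List Bool := condFn (Deciding p₁ p₂) (fun _ => [true]) fun _ => [false]

/-- **The query generator.** [folklore] -/
noncomputable def qgen : List Bool → List Bool :=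
  fanoutFn (modeQ p₁ p₂) (fanoutFn xQ (fanoutFn (KQ p₁ p₂) (fanoutFn (cQ p₁ p₂)
    (fanoutFn (fstF ∘ ksQ p₁ p₂) (preQ p₁ p₂)))))

/-- **`qgen ∈ FP`.** [Arora–Barak 2009, §1.3] [folklore] -/
theorem qgen_mem_FP : qgen p₁ p₂ ∈ FP := by
  have hx : xQ ∈ FP := comp_mem_FP fstF_mem_FP fstF_mem_FP
  have hy : yQ ∈ FP := comp_mem_FP sndF_mem_FP fstF_mem_FP
  have hbs : bsQ ∈ FP := sndF_mem_FP
  have hjr : jrQ p₁ p₂ ∈ FP := comp_mem_FP divModFn_mem_FP (fanoutFn_mem_FP (comp_mem_FP (polyFn_mem_FP _) hx)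
    (comp_mem_FP onesFn_mem_FP hbs))
  have hks : ksQ p₁ p₂ ∈ FP := comp_mem_FP divModFn_mem_FP (fanoutFn_mem_FP (comp_mem_FP (polyFn_mem_FP _) hx)
    (comp_mem_FP sndF_mem_FP hjr))
  have hK : KQ p₁ p₂ ∈ FP := comp_mem_FP takeFn_mem_FP (fanoutFn_mem_FP (comp_mem_FP umulFn_mem_FP
    (fanoutFn_mem_FP (comp_mem_FP fstF_mem_FP hjr) (comp_mem_FP (polyFn_mem_FP _) hx))) hbs)
  have hc : cQ p₁ p₂ ∈ FP := comp_mem_FP takeFn_mem_FP (fanoutFn_mem_FP (comp_mem_FP (polyFn_mem_FP _) hx)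
    (comp_mem_FP dropFn_mem_FP (fanoutFn_mem_FP (comp_mem_FP umulFn_mem_FP
      (fanoutFn_mem_FP (comp_mem_FP fstF_mem_FP hjr) (comp_mem_FP (polyFn_mem_FP _) hx))) hy)))
  have hlast : lastQ p₁ p₂ ∈ FP := append_mem_FP (comp_mem_FP dropFn_mem_FP (fanoutFn_mem_FP
    (comp_mem_FP dropFn_mem_FP (fanoutFn_mem_FP (comp_mem_FP sndF_mem_FP hks) (comp_mem_FP onesFn_mem_FP hbs))) hbs))
    (const_mem_FP _)
  have hS : Searching p₁ p₂ ∈ Classes.P := preimage_mem_P (LenLt_mem_P _) (fanoutFn_mem_FP hx hbs)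
  have hDc : Deciding p₁ p₂ ∈ Classes.P := preimage_mem_P (LenEq_mem_P _) (fanoutFn_mem_FP hx hbs)
  have hpre : preQ p₁ p₂ ∈ FP := condFn_mem_FP hS hlast (const_mem_FP _)
  have hmode : modeQ p₁ p₂ ∈ FP := condFn_mem_FP hDc (const_mem_FP _) (const_mem_FP _)
  exact fanoutFn_mem_FP hmode (fanoutFn_mem_FP hx (fanoutFn_mem_FP hK (fanoutFn_mem_FP hc
    (fanoutFn_mem_FP (comp_mem_FP fstF_mem_FP hks) hpre))))

variable (x y bs : List Bool)

/-- `onesFn w = 1^{|w|}`. [folklore] -/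
private theorem onesFn_eq_ones (w : List Bool) : onesFn w = ones w.length := by
  simp [onesFn, unaryEncodeNat_eq_replicate, ones]

/-- **The value of the query generator.** With `i = |bs|`, `LR`, `LB`, `ℓ`, `NQ` the parameters at
`n = |x|`, `j = i / LR`, `r = i mod LR`, `k = r / LB`, `s = r mod LB`:
`qgen ⟨⟨x, y⟩, bs⟩ = mkQ [i = NQ + 1] x (bs ↾ j·LR) ((y ⇂ jℓ) ↾ ℓ) k (if i < NQ then (bs ⇂ (i - s))·1 else ε)`.
[folklore] -/
theorem qgen_apply :
    qgen p₁ p₂ (boolPair (boolPair x y) bs) =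
      mkQ (decide (bs.length = (NQp p₁ p₂).eval x.length + 1)) x
        (bs.take (bs.length / (LRp p₁ p₂).eval x.length * (LRp p₁ p₂).eval x.length))
        ((y.drop (bs.length / (LRp p₁ p₂).eval x.length * (ellp p₁).eval x.length)).take ((ellp p₁).eval x.length))
        (bs.length % (LRp p₁ p₂).eval x.length / (LB p₁ p₂).eval x.length)
        (if bs.length < (NQp p₁ p₂).eval x.length then
          bs.drop (bs.length - bs.length % (LRp p₁ p₂).eval x.length % (LB p₁ p₂).eval x.length) ++ [true]
         else []) := by
  have hx : xQ (boolPair (boolPair x y) bs) = x := by simp [xQ]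
  have hy : yQ (boolPair (boolPair x y) bs) = y := by simp [yQ]
  have hbs : bsQ (boolPair (boolPair x y) bs) = bs := by simp [bsQ]
  set LR := (LRp p₁ p₂).eval x.length
  set L := (LB p₁ p₂).eval x.length
  set ℓ := (ellp p₁).eval x.length
  have hjr : jrQ p₁ p₂ (boolPair (boolPair x y) bs) = boolPair (ones (bs.length / LR)) (ones (bs.length % LR)) := by
    rw [jrQ, Function.comp_apply, fanoutFn_apply, Function.comp_apply, hx, polyFn_apply, Function.comp_apply, hbs,
      onesFn_eq_ones, divModFn_boolPair]
  have hks : ksQ p₁ p₂ (boolPair (boolPair x y) bs) =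
      boolPair (ones (bs.length % LR / L)) (ones (bs.length % LR % L)) := by
    rw [ksQ, Function.comp_apply, fanoutFn_apply, Function.comp_apply, hx, polyFn_apply, Function.comp_apply, hjr,
      sndF_boolPair, divModFn_boolPair]
  have hK : KQ p₁ p₂ (boolPair (boolPair x y) bs) = bs.take (bs.length / LR * LR) := by
    rw [KQ, Function.comp_apply, fanoutFn_apply, Function.comp_apply, fanoutFn_apply, Function.comp_apply, hjr,
      fstF_boolPair, Function.comp_apply, hx, polyFn_apply, umulFn_boolPair, hbs, takeFn_boolPair, List.length_replicate]
  have hc : cQ p₁ p₂ (boolPair (boolPair x y) bs) = (y.drop (bs.length / LR * ℓ)).take ℓ := by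
    rw [cQ, Function.comp_apply, fanoutFn_apply, Function.comp_apply, hx, polyFn_apply, Function.comp_apply,
      fanoutFn_apply, Function.comp_apply, fanoutFn_apply, Function.comp_apply, hjr, fstF_boolPair, Function.comp_apply,
      hx, polyFn_apply, umulFn_boolPair, hy, dropFn_boolPair, takeFn_boolPair, List.length_replicate,
      List.length_replicate]
  have hlast : lastQ p₁ p₂ (boolPair (boolPair x y) bs) = bs.drop (bs.length - bs.length % LR % L) ++ [true] := by
    rw [lastQ]
    simp only [Function.comp_apply, fanoutFn_apply, hks, sndF_boolPair, hbs, onesFn_eq_ones, dropFn_boolPair,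
      List.length_replicate, List.drop_replicate]
  have hpre : preQ p₁ p₂ (boolPair (boolPair x y) bs) =
      (if bs.length < (NQp p₁ p₂).eval x.length then bs.drop (bs.length - bs.length % LR % L) ++ [true] else []) := by
    rw [preQ, condFn_apply]
    have : boolPair (boolPair x y) bs ∈ Searching p₁ p₂ ↔ bs.length < (NQp p₁ p₂).eval x.length := by
      rw [Searching, memL_preimage, fanoutFn_apply, hx, hbs, boolPair_mem_LenLt]
    by_cases h : bs.length < (NQp p₁ p₂).eval x.length
    · rw [if_pos (this.2 h), if_pos h, hlast]
    · rw [if_neg (fun h' => h (this.1 h')), if_neg h]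
  have hmode : modeQ p₁ p₂ (boolPair (boolPair x y) bs) = [decide (bs.length = (NQp p₁ p₂).eval x.length + 1)] := by
    rw [modeQ, condFn_apply]
    have : boolPair (boolPair x y) bs ∈ Deciding p₁ p₂ ↔ bs.length = (NQp p₁ p₂).eval x.length + 1 := by
      rw [Deciding, memL_preimage, fanoutFn_apply, hx, hbs, boolPair_mem_LenEq, eval_add, eval_one]
    by_cases h : bs.length = (NQp p₁ p₂).eval x.length + 1
    · rw [if_pos (this.2 h), decide_eq_true h]
    · rw [if_neg (fun h' => h (this.1 h')), decide_eq_false h]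
  rw [qgen, fanoutFn_apply, fanoutFn_apply, fanoutFn_apply, fanoutFn_apply, fanoutFn_apply, hmode, hx, hK, hc,
    Function.comp_apply, hks, fstF_boolPair, hpre, mkQ]

end QGen

/-! ### The evaluators -/

section Dec

variable (p₁ p₂ : Polynomial ℕ)

/-- **The evaluator** `dec b₁ b₂`: on `⟨⟨x, y⟩, bs⟩` accept iff `bs[NQ] = b₁` and `bs[NQ + 1] = b₂`.
[folklore] -/
noncomputable def dec (b₁ b₂ : Bool) : Language Bool :=
  {z | (bitAtFn ∘ fanoutFn (polyFn (NQp p₁ p₂) ∘ xQ) bsQ) z = (fun _ => [b₁]) z} ⊓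
    {z | (bitAtFn ∘ fanoutFn (polyFn (NQp p₁ p₂ + 1) ∘ xQ) bsQ) z = (fun _ => [b₂]) z}

/-- `dec b₁ b₂ ∈ P`. [folklore] -/
theorem dec_mem_P (b₁ b₂ : Bool) : dec p₁ p₂ b₁ b₂ ∈ Classes.P := by
  have hx : xQ ∈ FP := comp_mem_FP fstF_mem_FP fstF_mem_FP
  exact inter_mem_P
    (setOf_apply_eq_apply_mem_P (comp_mem_FP bitAtFn_mem_FP (fanoutFn_mem_FP (comp_mem_FP (polyFn_mem_FP _) hx)
      sndF_mem_FP)) (const_mem_FP _))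
    (setOf_apply_eq_apply_mem_P (comp_mem_FP bitAtFn_mem_FP (fanoutFn_mem_FP (comp_mem_FP (polyFn_mem_FP _) hx)
      sndF_mem_FP)) (const_mem_FP _))

/-- **Semantics of the evaluator** on an answer string of length `> NQ + 1`. [folklore] -/
theorem mem_dec_iff (b₁ b₂ : Bool) (x y bs : List Bool) (h : (NQp p₁ p₂).eval x.length + 1 < bs.length) :
    boolPair (boolPair x y) bs ∈ dec p₁ p₂ b₁ b₂ ↔
      bs[(NQp p₁ p₂).eval x.length]'(by omega) = b₁ ∧ bs[(NQp p₁ p₂).eval x.length + 1]'h = b₂ := by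
  have hx : xQ (boolPair (boolPair x y) bs) = x := by simp [xQ]
  have hbs : bsQ (boolPair (boolPair x y) bs) = bs := by simp [bsQ]
  have h1 := bitAtFn_boolPair_of_lt (ones ((NQp p₁ p₂).eval x.length)) bs (by rw [List.length_replicate]; omega)
  have h2 := bitAtFn_boolPair_of_lt (ones ((NQp p₁ p₂).eval x.length + 1)) bs (by rw [List.length_replicate]; omega)
  rw [dec, memL_inf, memL_setOf, memL_setOf]
  simp only [Function.comp_apply, fanoutFn_apply, hx, hbs, polyFn_apply, eval_add, eval_one, h1, h2,
    List.length_replicate, List.cons.injEq, and_true]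

end Dec

/-! ### The prefix search -/

section Greedy

open scoped Classical

/-- **The greedy prefix search** through the oracle: extend the current prefix by `1` if some string
with the property extends `prefix·1`, else by `0`. [Arora–Barak 2009, Thm. 2.18 (search to decision)]
[cite: AroraBarak2009, Thm. 2.18] -/
noncomputable def greedy (P : List Bool → Prop) : ℕ → List Bool
  | 0 => []
  | s + 1 => greedy P s ++ [decide (∃ z, P z ∧ greedy P s ++ [true] <+: z)]

/-- `|greedy P s| = s`. [folklore] -/
@[simp] theorem length_greedy (P : List Bool → Prop) : ∀ s, (greedy P s).length = s
  | 0 => rfl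
  | s + 1 => by rw [greedy, List.length_append, length_greedy P s, List.length_singleton]

/-- Earlier stages are prefixes of later ones. [folklore] -/
theorem greedy_take (P : List Bool → Prop) {s s' : ℕ} (h : s ≤ s') : (greedy P s').take s = greedy P s := by
  induction s' with
  | zero => obtain rfl : s = 0 := Nat.le_zero.1 h; rfl
  | succ s' ih =>
    rcases Nat.lt_or_eq_of_le h with hlt | rfl
    · rw [greedy, List.take_append_of_le_length (by rw [length_greedy]; omega)]
      exact ih (by omega)
    · rw [List.take_of_length_le (by rw [length_greedy])]

/-- **The greedy search succeeds**: if some string has the property and all such strings have length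
`LB`, the search ends in one of them (invariant: the current prefix extends to such a string).
[Arora–Barak 2009, Thm. 2.18] [cite: AroraBarak2009, Thm. 2.18] -/
theorem greedy_spec {P : List Bool → Prop} {LB : ℕ} (hne : ∃ z, P z) (hlen : ∀ z, P z → z.length = LB) :
    P (greedy P LB) := by
  have inv : ∀ s ≤ LB, ∃ z, P z ∧ greedy P s <+: z := by
    intro s
    induction s with
    | zero => intro _; obtain ⟨z, hz⟩ := hne; exact ⟨z, hz, List.nil_prefix⟩
    | succ s ih =>
      intro hs
      obtain ⟨z, hz, hpz⟩ := ih (by omega)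
      rw [greedy]
      by_cases h : ∃ z, P z ∧ greedy P s ++ [true] <+: z
      · rw [decide_eq_true h]; exact h
      · rw [decide_eq_false h]
        refine ⟨z, hz, ?_⟩
        -- `z = greedy·b·rest` with `b ≠ 1`
        obtain ⟨t, rfl⟩ := hpz
        have hzl := hlen _ hz
        rw [List.length_append, length_greedy] at hzl
        cases t with
        | nil => simp at hzl; omega
        | cons b t =>
          cases b
          · exact ⟨t, by simp⟩
          · exact (h ⟨_, hz, ⟨t, by simp⟩⟩).elim
  obtain ⟨z, hz, hpz⟩ := inv LB le_rfl
  have : greedy P LB = z := hpz.eq_of_length (by rw [length_greedy, hlen z hz])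
  rw [this]; exact hz

end Greedy

/-- Mathlib's `Set.boolIndicator` is the classical `decide` (a copy of the two-line lemma of
`AlmostPProofs.lean`). [folklore] -/
private theorem boolIndicator_eq_decide' (A : Language Bool) (u : List Bool) :
    A.boolIndicator u = @decide (u ∈ A) (Classical.propDecidable _) := by
  unfold Set.boolIndicator
  cases Classical.propDecidable (u ∈ A) <;> rfl

/-- Reading the two symbols after a prefix of known length. [folklore] -/
theorem getElem_append_pair {l : List Bool} {a b : Bool} {n : ℕ} (hl : l.length = n)
    (h₁ : n < (l ++ [a, b]).length) (h₂ : n + 1 < (l ++ [a, b]).length) :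
    (l ++ [a, b])[n] = a ∧ (l ++ [a, b])[n + 1] = b := by
  subst hl
  simp [List.getElem_append_right]

/-! ### The answer string: rounds, blocks, and the two final answers -/

section Run

open scoped Classical

variable (p₁ p₂ : Polynomial ℕ) (Rp : Language Bool) (cw : List Bool → List Bool) (x y : List Bool)

/-- The block length `LB(n)`. [folklore] -/
noncomputable def Lv : ℕ := (LB p₁ p₂).eval x.length
/-- Queries per round `LR(n) = (p₁ n + 4) · LB(n)`. [folklore] -/
noncomputable def LRv : ℕ := (p₁.eval x.length + 4) * Lv p₁ p₂ x
/-- Coins per round `ℓ(n)`. [folklore] -/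
noncomputable def ellv : ℕ := (p₁.eval x.length + 3) * (p₁.eval x.length + 2)
/-- Rounds `T(n)`. [folklore] -/
noncomputable def Tv : ℕ := 8 * (p₁.eval x.length + 2)
/-- Search queries `NQ(n) = T(n) · LR(n)`. [folklore] -/
noncomputable def NQv : ℕ := Tv p₁ x * LRv p₁ p₂ x

/-- The block-length polynomial evaluates to `Lv`. [folklore] -/
theorem eval_Lv : (LB p₁ p₂).eval x.length = Lv p₁ p₂ x := rfl

/-- The polynomial parameters evaluate to these numbers. [folklore] -/
theorem eval_LRp : (LRp p₁ p₂).eval x.length = LRv p₁ p₂ x := by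
  rw [(eval_params p₁ p₂ x.length).2.1]; rfl

/-- The polynomial parameters evaluate to these numbers. [folklore] -/
theorem eval_ellp : (ellp p₁).eval x.length = ellv p₁ x := by simp [ellp, ellv]

/-- The polynomial parameters evaluate to these numbers. [folklore] -/
theorem eval_NQp : (NQp p₁ p₂).eval x.length = NQv p₁ p₂ x := by
  rw [(eval_params p₁ p₂ x.length).2.2.2.2.1]; rfl

/-- `LB(n) ≥ 2`. [folklore] -/
theorem two_le_Lv : 2 ≤ Lv p₁ p₂ x := two_le_LB p₁ p₂ x.length

/-- `LR(n) ≥ 2`. [folklore] -/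
theorem two_le_LRv : 2 ≤ LRv p₁ p₂ x := by
  have := two_le_Lv p₁ p₂ x; unfold LRv; nlinarith

/-- **The answer bits** of the adaptive run on `⟨x, y⟩`. [folklore] -/
noncomputable def AB (i : ℕ) : List Bool := adBits (qgen p₁ p₂) (orc p₁ p₂ Rp cw) (boolPair x y) i

/-- The coins of round `j`. [folklore] -/
noncomputable def coinsOf (j : ℕ) : List Bool := (y.drop (j * ellv p₁ x)).take (ellv p₁ x)

/-- **The strings searched** at level `k` with advice bits `K` and coins `c`: those passing the
verifier with no prefix requirement. [folklore] -/
def Zs (K c : List Bool) (k : ℕ) (z : List Bool) : Prop := VerCond p₁ p₂ Rp cw false x K c k [] z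

/-- A prefix requirement is a prefix requirement. [folklore] -/
theorem verCond_pre_iff (mode : Bool) (K c : List Bool) (k : ℕ) (pre z : List Bool) :
    VerCond p₁ p₂ Rp cw mode x K c k pre z ↔ pre <+: z ∧ VerCond p₁ p₂ Rp cw mode x K c k [] z := by
  unfold VerCond
  simp only [List.nil_prefix, true_and]

/-- Searched strings have length `LB(n)`. [folklore] -/
theorem length_of_Zs {K c : List Bool} {k : ℕ} {z : List Bool} (hz : Zs p₁ p₂ Rp cw x K c k z) :
    z.length = Lv p₁ p₂ x := hz.2.1

/-- **The round block**: the `NB` greedy searches of one round, concatenated. [folklore] -/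
noncomputable def roundBits (K c : List Bool) : List Bool :=
  (List.range (p₁.eval x.length + 4)).flatMap fun k => greedy (Zs p₁ p₂ Rp cw x K c k) (Lv p₁ p₂ x)

/-- `|roundBits| = LR(n)`. [folklore] -/
theorem length_roundBits (K c : List Bool) : (roundBits p₁ p₂ Rp cw x K c).length = LRv p₁ p₂ x := by
  rw [roundBits, List.length_flatMap, LRv]
  simp [List.sum_replicate]

/-- The bad-test query on an advice `K` (level `0`, no prefix; the coins are immaterial). [folklore] -/
noncomputable def badQ (K : List Bool) : List Bool := mkQ false x K (coinsOf p₁ x y (Tv p₁ x)) 0 []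

/-- The decision query on an advice `K`. [folklore] -/
noncomputable def decQ (K : List Bool) : List Bool := mkQ true x K (coinsOf p₁ x y (Tv p₁ x)) 0 []

variable {p₁ p₂ Rp cw x y}

/-- One more answer bit. [folklore] -/
theorem AB_succ (i : ℕ) : AB p₁ p₂ Rp cw x y (i + 1) =
    AB p₁ p₂ Rp cw x y i ++ [(orc p₁ p₂ Rp cw).boolIndicator (qgen p₁ p₂ (boolPair (boolPair x y) (AB p₁ p₂ Rp cw x y i)))] :=
  adBits_succ _ _ i

/-- `|AB i| = i`. [folklore] -/
@[simp] theorem length_AB (i : ℕ) : (AB p₁ p₂ Rp cw x y i).length = i := length_adBits _ _ i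

/-- Prefixes of the answer string. [folklore] -/
theorem AB_take {i i' : ℕ} (h : i ≤ i') : (AB p₁ p₂ Rp cw x y i').take i = AB p₁ p₂ Rp cw x y i :=
  adBits_take _ _ h

/-- Index arithmetic of the schedule. [folklore] -/
theorem sched {LR L NB j k s : ℕ} (hLR : LR = NB * L) (hk : k < NB) (hs : s < L) :
    (j * LR + k * L + s) / LR = j ∧ (j * LR + k * L + s) % LR = k * L + s ∧
      (k * L + s) / L = k ∧ (k * L + s) % L = s := by
  have hL : 0 < L := by omega
  have hlt : k * L + s < LR := by
    rw [hLR]; have : (k + 1) * L ≤ NB * L := Nat.mul_le_mul_right L hk; rw [Nat.succ_mul] at this; omega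
  have hLRpos : 0 < LR := by omega
  refine ⟨?_, ?_, ?_, ?_⟩
  · rw [add_assoc, mul_comm, Nat.mul_add_div hLRpos, Nat.div_eq_of_lt hlt, add_zero]
  · rw [add_assoc, mul_comm, Nat.mul_add_mod, Nat.mod_eq_of_lt hlt]
  · rw [mul_comm, Nat.mul_add_div hL, Nat.div_eq_of_lt hs, add_zero]
  · rw [mul_comm, Nat.mul_add_mod, Nat.mod_eq_of_lt hs]

/-- **The block of level `k` in round `j` is the greedy search** over `Zs (AB (j·LR)) (coins j) k`:
after `s ≤ LB` steps the answers of the block are its first `s` stages. [folklore] -/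
theorem block_eq_greedy {j k : ℕ} (hj : j < Tv p₁ x) (hk : k < p₁.eval x.length + 4) :
    ∀ s ≤ Lv p₁ p₂ x,
      (AB p₁ p₂ Rp cw x y (j * LRv p₁ p₂ x + k * Lv p₁ p₂ x + s)).drop (j * LRv p₁ p₂ x + k * Lv p₁ p₂ x) =
        greedy (Zs p₁ p₂ Rp cw x (AB p₁ p₂ Rp cw x y (j * LRv p₁ p₂ x)) (coinsOf p₁ x y j) k) s
  | 0, _ => by
    rw [add_zero, List.drop_eq_nil_of_le (by rw [length_AB])]; rfl
  | s + 1, hs => by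
    have ih := block_eq_greedy hj hk s (by omega)
    have hLRdef : LRv p₁ p₂ x = (p₁.eval x.length + 4) * Lv p₁ p₂ x := rfl
    have hsch := sched (j := j) hLRdef hk (show s < Lv p₁ p₂ x by omega)
    have hiNQ : j * LRv p₁ p₂ x + k * Lv p₁ p₂ x + s < NQv p₁ p₂ x := by
      have h1 : k * Lv p₁ p₂ x + s < LRv p₁ p₂ x := by
        have : (k + 1) * Lv p₁ p₂ x ≤ (p₁.eval x.length + 4) * Lv p₁ p₂ x := Nat.mul_le_mul_right _ hk
        rw [Nat.succ_mul] at this; omega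
      have h2 : (j + 1) * LRv p₁ p₂ x ≤ Tv p₁ x * LRv p₁ p₂ x := Nat.mul_le_mul_right _ hj
      rw [Nat.succ_mul] at h2
      have : NQv p₁ p₂ x = Tv p₁ x * LRv p₁ p₂ x := rfl
      omega
    have hq : qgen p₁ p₂ (boolPair (boolPair x y) (AB p₁ p₂ Rp cw x y (j * LRv p₁ p₂ x + k * Lv p₁ p₂ x + s))) =
        mkQ false x (AB p₁ p₂ Rp cw x y (j * LRv p₁ p₂ x)) (coinsOf p₁ x y j) k
          (greedy (Zs p₁ p₂ Rp cw x (AB p₁ p₂ Rp cw x y (j * LRv p₁ p₂ x)) (coinsOf p₁ x y j) k) s ++ [true]) := by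
      rw [qgen_apply, length_AB, eval_LRp, eval_NQp, eval_ellp, eval_Lv, hsch.1, hsch.2.1, hsch.2.2.1,
        hsch.2.2.2, if_pos hiNQ, AB_take (by omega), decide_eq_false (by omega),
        show j * LRv p₁ p₂ x + k * Lv p₁ p₂ x + s - s = j * LRv p₁ p₂ x + k * Lv p₁ p₂ x by omega, ih]
      rfl
    rw [show j * LRv p₁ p₂ x + k * Lv p₁ p₂ x + (s + 1) = j * LRv p₁ p₂ x + k * Lv p₁ p₂ x + s + 1 by omega, AB_succ,
      List.drop_append_of_le_length (by rw [length_AB]; omega), ih, greedy, hq, boolIndicator_eq_decide',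
      List.append_cancel_left_eq, List.singleton_inj]
    refine decide_eq_decide.2 ?_
    rw [mem_orc_iff]
    simp only [verCond_pre_iff p₁ p₂ Rp cw x false _ _ k (greedy _ s ++ [true]), Zs]
    exact ⟨fun ⟨z, h1, h2⟩ => ⟨z, h2, h1⟩, fun ⟨z, h1, h2⟩ => ⟨z, h2, h1⟩⟩

/-- **One round appends the round block.** [folklore] -/
theorem AB_round {j : ℕ} (hj : j < Tv p₁ x) :
    AB p₁ p₂ Rp cw x y ((j + 1) * LRv p₁ p₂ x) =
      AB p₁ p₂ Rp cw x y (j * LRv p₁ p₂ x) ++ roundBits p₁ p₂ Rp cw x (AB p₁ p₂ Rp cw x y (j * LRv p₁ p₂ x)) (coinsOf p₁ x y j) := by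
  have key : ∀ m ≤ p₁.eval x.length + 4, AB p₁ p₂ Rp cw x y (j * LRv p₁ p₂ x + m * Lv p₁ p₂ x) =
      AB p₁ p₂ Rp cw x y (j * LRv p₁ p₂ x) ++ (List.range m).flatMap fun k =>
        greedy (Zs p₁ p₂ Rp cw x (AB p₁ p₂ Rp cw x y (j * LRv p₁ p₂ x)) (coinsOf p₁ x y j) k) (Lv p₁ p₂ x) := by
    intro m
    induction m with
    | zero => intro _; simp
    | succ m ih =>
      intro hm
      have h1 := ih (by omega)
      have h2 := block_eq_greedy (Rp := Rp) (cw := cw) (y := y) hj (show m < p₁.eval x.length + 4 by omega)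
        (Lv p₁ p₂ x) le_rfl
      rw [← List.take_append_drop (j * LRv p₁ p₂ x + m * Lv p₁ p₂ x)
          (AB p₁ p₂ Rp cw x y (j * LRv p₁ p₂ x + (m + 1) * Lv p₁ p₂ x)),
        AB_take (by rw [Nat.succ_mul]; omega),
        h1, show j * LRv p₁ p₂ x + (m + 1) * Lv p₁ p₂ x = j * LRv p₁ p₂ x + m * Lv p₁ p₂ x + Lv p₁ p₂ x by ring,
        h2, List.range_succ, List.flatMap_append, List.flatMap_singleton, List.append_assoc]
  have := key (p₁.eval x.length + 4) le_rfl
  rw [show j * LRv p₁ p₂ x + (p₁.eval x.length + 4) * Lv p₁ p₂ x = (j + 1) * LRv p₁ p₂ x by rw [LRv]; ring] at this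
  exact this

/-- **The two final answers**: the bad test and the decision query on the advice `AB NQ`. [folklore] -/
theorem AB_final :
    AB p₁ p₂ Rp cw x y (NQv p₁ p₂ x + 2) = AB p₁ p₂ Rp cw x y (NQv p₁ p₂ x) ++
      [(orc p₁ p₂ Rp cw).boolIndicator (badQ p₁ x y (AB p₁ p₂ Rp cw x y (NQv p₁ p₂ x))),
       (orc p₁ p₂ Rp cw).boolIndicator (decQ p₁ x y (AB p₁ p₂ Rp cw x y (NQv p₁ p₂ x)))] := by
  have hLR2 := two_le_LRv p₁ p₂ x
  have hL2 := two_le_Lv p₁ p₂ x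
  have hNQ : NQv p₁ p₂ x = Tv p₁ x * LRv p₁ p₂ x := rfl
  have hT : NQv p₁ p₂ x / LRv p₁ p₂ x = Tv p₁ x := by rw [hNQ, Nat.mul_div_cancel _ (by omega)]
  have hT' : (NQv p₁ p₂ x + 1) / LRv p₁ p₂ x = Tv p₁ x := by
    rw [hNQ, mul_comm, Nat.mul_add_div (by omega), Nat.div_eq_of_lt (by omega), add_zero]
  have hm0 : NQv p₁ p₂ x % LRv p₁ p₂ x / Lv p₁ p₂ x = 0 := by rw [hNQ, Nat.mul_mod_left, Nat.zero_div]
  have hm1 : (NQv p₁ p₂ x + 1) % LRv p₁ p₂ x / Lv p₁ p₂ x = 0 := by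
    rw [hNQ, mul_comm, Nat.mul_add_mod, Nat.mod_eq_of_lt (by omega), Nat.div_eq_of_lt (by omega)]
  have h1 : AB p₁ p₂ Rp cw x y (NQv p₁ p₂ x + 1) = AB p₁ p₂ Rp cw x y (NQv p₁ p₂ x) ++
      [(orc p₁ p₂ Rp cw).boolIndicator (badQ p₁ x y (AB p₁ p₂ Rp cw x y (NQv p₁ p₂ x)))] := by
    rw [AB_succ, qgen_apply, length_AB, eval_LRp, eval_NQp, eval_ellp, eval_Lv, hT, hm0,
      if_neg (lt_irrefl _), decide_eq_false (by omega), ← hNQ, List.take_of_length_le (by rw [length_AB])]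
    rfl
  rw [AB_succ, h1, qgen_apply, List.length_append, length_AB, List.length_singleton, eval_LRp, eval_NQp,
    eval_ellp, eval_Lv, hT', hm1, if_neg (by omega), decide_eq_true rfl, ← hNQ,
    List.take_append_of_le_length (by rw [length_AB]), List.take_of_length_le (by rw [length_AB]),
    List.append_assoc]
  rfl

/-- **Membership in the reduced language**: the evaluator `dec b₁ b₂` reads the two final answers.
[folklore] -/
theorem mem_adLang_dec_iff (b₁ b₂ : Bool) :
    boolPair x y ∈ adLang (qgen p₁ p₂) (NQp p₁ p₂ + 2) (dec p₁ p₂ b₁ b₂) (orc p₁ p₂ Rp cw) ↔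
      (orc p₁ p₂ Rp cw).boolIndicator (badQ p₁ x y (AB p₁ p₂ Rp cw x y (NQv p₁ p₂ x))) = b₁ ∧
        (orc p₁ p₂ Rp cw).boolIndicator (decQ p₁ x y (AB p₁ p₂ Rp cw x y (NQv p₁ p₂ x))) = b₂ := by
  set N' := (NQp p₁ p₂ + 2).eval (boolPair x y).length with hN'
  have hmono : NQv p₁ p₂ x + 2 ≤ N' := by
    rw [hN', eval_add, ← eval_NQp]
    have := TM2Iter.eval_mono (NQp p₁ p₂) (show x.length ≤ (boolPair x y).length by rw [length_boolPair]; omega)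
    simp only [eval_ofNat]; omega
  rw [mem_adLang_iff, mem_dec_iff p₁ p₂ b₁ b₂ x y _ (by rw [length_adBits, eval_NQp]; omega)]
  have htake : (adBits (qgen p₁ p₂) (orc p₁ p₂ Rp cw) (boolPair x y) N').take (NQv p₁ p₂ x + 2) =
      AB p₁ p₂ Rp cw x y (NQv p₁ p₂ x + 2) := adBits_take _ _ hmono
  have hget : ∀ (i : ℕ) (hi : i < NQv p₁ p₂ x + 2) (hi' : i < (adBits (qgen p₁ p₂) (orc p₁ p₂ Rp cw) (boolPair x y) N').length),
      (adBits (qgen p₁ p₂) (orc p₁ p₂ Rp cw) (boolPair x y) N')[i] =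
        (AB p₁ p₂ Rp cw x y (NQv p₁ p₂ x + 2))[i]'(by rw [length_AB]; exact hi) := by
    intro i hi hi'
    simp only [← htake, List.getElem_take]
  simp only [eval_NQp]
  rw [hget _ (by omega), hget _ (by omega)]
  have hp := getElem_append_pair (a := (orc p₁ p₂ Rp cw).boolIndicator (badQ p₁ x y (AB p₁ p₂ Rp cw x y (NQv p₁ p₂ x))))
    (b := (orc p₁ p₂ Rp cw).boolIndicator (decQ p₁ x y (AB p₁ p₂ Rp cw x y (NQv p₁ p₂ x))))
    (length_AB (p₁ := p₁) (p₂ := p₂) (Rp := Rp) (cw := cw) (x := x) (y := y) (NQv p₁ p₂ x))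
    (by simp) (by simp)
  simp only [AB_final]
  rw [hp.1, hp.2]

end Run

end CFKer

end Literature.Computability.Complexity

/-! # Part V: assembly and discharge -/

namespace Literature.Computability.Complexity

open _root_.Computability Polynomial Brick Stockmeyer AffineHash Finset

open scoped Classical

namespace CFKer

/-! ### Strings of bounded length -/

/-- All strings of length `≤ m`. [folklore] -/
noncomputable def strLe (m : ℕ) : Finset (List Bool) :=
  (range (m + 1)).biUnion fun i => (univ : Finset (List.Vector Bool i)).image List.Vector.toList

/-- Membership in `strLe`. [folklore] -/
@[simp] theorem mem_strLe {m : ℕ} {u : List Bool} : u ∈ strLe m ↔ u.length ≤ m := by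
  unfold strLe
  simp only [mem_biUnion, mem_range, mem_image, mem_univ, true_and]
  constructor
  · rintro ⟨i, hi, v, rfl⟩; rw [v.toList_length]; omega
  · intro h; exact ⟨u.length, by omega, ⟨u, rfl⟩, rfl⟩

/-- `|strLe m| ≤ 2^{m+1}`. [folklore] -/
theorem card_strLe_le (m : ℕ) : (strLe m).card ≤ 2 ^ (m + 1) := by
  unfold strLe
  refine card_biUnion_le.trans ?_
  have h : ∀ i ∈ range (m + 1), ((univ : Finset (List.Vector Bool i)).image List.Vector.toList).card ≤ 2 ^ i :=
    fun i _ => card_image_le.trans (by rw [card_univ, card_vector, Fintype.card_bool])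
  refine (sum_le_sum h).trans ?_
  have : ∀ n, ∑ i ∈ range (n + 1), 2 ^ i ≤ 2 ^ (n + 1) := by
    intro n; induction n with
    | zero => simp
    | succ n ih => rw [sum_range_succ, pow_succ]; omega
  exact this m

/-! ### The bad set of an advice string, and the oracle's three questions -/

section Semantics

variable (p₁ p₂ : Polynomial ℕ) (Rp : Language Bool) (cw : List Bool → List Bool) (x : List Bool)

/-- **The bad set** of the advice bits `K`: elements `u`, `|u| ≤ p₁(n)`, whose instance `⟨x, u⟩` is bad
for the entries of the full blocks of `K` (part I: a member passing the certificate).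
[HNOS 1996, proof of Thm. 1] [folklore] -/
noncomputable def BdK (K : List Bool) : Finset (List Bool) :=
  (strLe (p₁.eval x.length)).filter fun u => Bad Rp cw (entriesOf (Lv p₁ p₂ x) K) (boolPair x u)

/-- The element `u` of a searched string `z = ⟨⟨⟨x, u⟩, wa⟩, junk⟩`. [folklore] -/
def uOf (z : List Bool) : List Bool := sndF (fstF (fstF z))

variable {p₁ p₂ Rp cw x}

/-- Membership in the bad set. [folklore] -/
theorem mem_BdK {K u : List Bool} :
    u ∈ BdK p₁ p₂ Rp cw x K ↔ u.length ≤ p₁.eval x.length ∧ Bad Rp cw (entriesOf (Lv p₁ p₂ x) K) (boolPair x u) := by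
  rw [BdK, mem_filter, mem_strLe]

/-- **What a searched string proves**: its element is short and bad, its entry is valid with
instance `⟨x, u⟩`, and `u·1` hashes to zero at the level searched. [folklore] -/
theorem zs_sound {K c : List Bool} {k : ℕ} {z : List Bool} (hz : Zs p₁ p₂ Rp cw x K c k z) :
    uOf z ∈ BdK p₁ p₂ Rp cw x K ∧ fstF (fstF z) = boolPair x (uOf z) ∧ ValidE Rp (fstF z) ∧
      HashesToZero c (p₁.eval x.length + 1) k (mark (uOf z)) := by
  obtain ⟨-, -, ha, hu, hval, hhash, hcert⟩ := hz
  have hval' : boolPair (fstF (fstF z)) (sndF (fstF z)) ∈ Rp := hval.resolve_left (by decide)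
  refine ⟨mem_BdK.2 ⟨hu, ?_⟩, ha, ?_, hhash⟩
  · change Bad Rp cw (entriesOf (Lv p₁ p₂ x) K) (boolPair x (sndF (fstF (fstF z))))
    rw [← ha]; exact ⟨⟨_, hval'⟩, hcert⟩
  · exact hval'

section Room

variable {R : Language Bool}

/-- **Room in a block** for the entry of a short element with a bounded witness:
`2 |⟨⟨x, u⟩, wa⟩| + 2 ≤ LB(n)` when `|u| ≤ p₁ n`, `|wa| ≤ p₂ |⟨x, u⟩|`. [folklore] -/
theorem room {u wa : List Bool} (hu : u.length ≤ p₁.eval x.length)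
    (hwa : wa.length ≤ p₂.eval (boolPair x u).length) :
    2 * (boolPair (boolPair x u) wa).length + 2 ≤ Lv p₁ p₂ x := by
  have hmono : p₂.eval (boolPair x u).length ≤ p₂.eval (2 * x.length + 2 + p₁.eval x.length) := by
    apply TM2Iter.eval_mono; rw [length_boolPair]; omega
  simp only [Lv, LB, length_boolPair, eval_add, eval_mul, eval_ofNat, eval_X, eval_comp] at *
  omega

/-- **The canonical searched string** of an entry: `⟨⟨⟨x, u⟩, wa⟩, 0^r⟩` padded to length `LB(n)`.
[folklore] -/
noncomputable def mkZ (p₁ p₂ : Polynomial ℕ) (x u wa : List Bool) : List Bool :=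
  boolPair (boolPair (boolPair x u) wa)
    (List.replicate (Lv p₁ p₂ x - (2 * (boolPair (boolPair x u) wa).length + 2)) false)

/-- The canonical searched string passes the verifier (any mode) when its element is short, passes
the certificate, hashes to zero, and the witness is bounded (and valid unless `mode = 1`). [folklore] -/
theorem verCond_mkZ {mode : Bool} {K c u wa : List Bool} {k : ℕ} (hu : u.length ≤ p₁.eval x.length)
    (hwa : wa.length ≤ p₂.eval (boolPair x u).length)
    (hval : mode = true ∨ boolPair (boolPair x u) wa ∈ Rp)
    (hhash : HashesToZero c (p₁.eval x.length + 1) k (mark u))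
    (hcert : Cert Rp cw (entriesOf (Lv p₁ p₂ x) K) (boolPair x u)) :
    VerCond p₁ p₂ Rp cw mode x K c k [] (mkZ p₁ p₂ x u wa) := by
  have hr := room (p₁ := p₁) (p₂ := p₂) hu hwa
  refine ⟨List.nil_prefix, ?_, ?_, ?_, ?_, ?_, ?_⟩
  · rw [mkZ, length_boolPair, List.length_replicate]
    change _ = Lv p₁ p₂ x
    omega
  · simp [mkZ]
  · simpa [mkZ] using hu
  · simpa [mkZ] using hval
  · simpa [mkZ, mark] using hhash
  · simpa [mkZ, Lv] using hcert

/-- Its element. [folklore] -/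
@[simp] theorem uOf_mkZ (u wa : List Bool) : uOf (mkZ p₁ p₂ x u wa) = u := by simp [uOf, mkZ]

end Room

variable (hRp : ∀ a w, boolPair a w ∈ Rp → w.length ≤ p₂.eval a.length)
include hRp

/-- **What makes a string searched**: a short bad element hashed to zero has a searched string with
that element. [folklore] -/
theorem zs_complete {K c : List Bool} {k : ℕ} {u : List Bool} (hu : u ∈ BdK p₁ p₂ Rp cw x K)
    (hhash : HashesToZero c (p₁.eval x.length + 1) k (mark u)) :
    ∃ z, Zs p₁ p₂ Rp cw x K c k z ∧ uOf z = u := by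
  obtain ⟨hul, ⟨wa, hwa⟩, hcert⟩ := mem_BdK.1 hu
  exact ⟨mkZ p₁ p₂ x u wa, verCond_mkZ hul (hRp _ _ hwa) (Or.inr hwa) hhash hcert, uOf_mkZ u wa⟩

/-- **The bad test**: the level-`0` search query with no prefix is in the oracle iff the bad set is
nonempty. [folklore] -/
theorem badQ_mem_iff (K c : List Bool) :
    mkQ false x K c 0 [] ∈ orc p₁ p₂ Rp cw ↔ (BdK p₁ p₂ Rp cw x K).Nonempty := by
  rw [mem_orc_iff]
  constructor
  · rintro ⟨z, hz⟩; exact ⟨uOf z, (zs_sound hz).1⟩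
  · rintro ⟨u, hu⟩
    obtain ⟨z, hz, -⟩ := zs_complete hRp hu (fun j hj => (Nat.not_lt_zero j hj).elim)
    exact ⟨z, hz⟩

omit hRp in
/-- **The decision query**: in the oracle iff some short `u` passes the certificate. [folklore] -/
theorem decQ_mem_iff (K c : List Bool) :
    mkQ true x K c 0 [] ∈ orc p₁ p₂ Rp cw ↔
      ∃ u, u.length ≤ p₁.eval x.length ∧ Cert Rp cw (entriesOf (Lv p₁ p₂ x) K) (boolPair x u) := by
  rw [mem_orc_iff]
  constructor
  · rintro ⟨z, -, -, ha, hu, -, -, hcert⟩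
    refine ⟨uOf z, hu, ?_⟩
    change Cert Rp cw (entriesOf (Lv p₁ p₂ x) K) (boolPair x (sndF (fstF (fstF z))))
    rw [← ha]; exact hcert
  · rintro ⟨u, hu, hcert⟩
    exact ⟨mkZ p₁ p₂ x u [], verCond_mkZ hu (by simp) (Or.inl rfl) (fun j hj => (Nat.not_lt_zero j hj).elim) hcert⟩

omit hRp in
/-- **Good advice decides**: if the bad set is empty, "some short `u` passes the certificate" is
"some short `u` has `⟨x, u⟩ ∉ N`" (part I, `not_hasWit_iff_cert`). [HNOS 1996, proof of Thm. 1] [folklore] -/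
theorem good_decision (hcw : IsCanonWitFn (R₂ Rp) cw) {K : List Bool} (hK : BdK p₁ p₂ Rp cw x K = ∅) :
    (∃ u, u.length ≤ p₁.eval x.length ∧ Cert Rp cw (entriesOf (Lv p₁ p₂ x) K) (boolPair x u)) ↔
      ∃ u, u.length ≤ p₁.eval x.length ∧ ¬ HasWit Rp (boolPair x u) := by
  have hgood : ∀ a ∈ {a : List Bool | ∃ u, u.length ≤ p₁.eval x.length ∧ a = boolPair x u},
      ¬ Bad Rp cw (entriesOf (Lv p₁ p₂ x) K) a := by
    rintro a ⟨u, hu, rfl⟩ hbad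
    have : u ∈ BdK p₁ p₂ Rp cw x K := mem_BdK.2 ⟨hu, hbad⟩
    rw [hK] at this; exact (Finset.notMem_empty u this)
  constructor
  · rintro ⟨u, hu, hc⟩
    exact ⟨u, hu, (not_hasWit_iff_cert hcw hgood ⟨u, hu, rfl⟩).2 hc⟩
  · rintro ⟨u, hu, hn⟩
    exact ⟨u, hu, (not_hasWit_iff_cert hcw hgood ⟨u, hu, rfl⟩).1 hn⟩

end Semantics

/-! ### The round map of the machine satisfies the hypotheses of the halving lemma -/

section Halving

variable (p₁ p₂ : Polynomial ℕ) (Rp : Language Bool) (cw : List Bool → List Bool) (x : List Bool)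

/-- **States** of the advice process: advice strings made of full blocks. [folklore] -/
def St : Type := {K : List Bool // K.length % Lv p₁ p₂ x = 0}

/-- The empty advice. [folklore] -/
def st0 : St p₁ p₂ x := ⟨[], by simp⟩

/-- **The round map**: append the round block computed from the current advice and the coins.
[folklore] -/
noncomputable def nextS (K : St p₁ p₂ x) (c : List Bool) : St p₁ p₂ x :=
  ⟨K.1 ++ roundBits p₁ p₂ Rp cw x K.1 c, by
    rw [List.length_append, length_roundBits, LRv, Nat.add_mod, K.2, Nat.mul_mod_left]; simp⟩

/-- **The beating relation on elements** (with any valid witness of the beating element; part I,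
`beats_congr`: the choice is immaterial). [folklore] -/
def beatR (u' u : List Bool) : Prop :=
  ∃ w', boolPair (boolPair x u') w' ∈ Rp ∧ beats cw (boolPair x u') w' (boolPair x u)

/-- **What the level-`k` search of a round returns**: the element of the greedy string, if the level is
searched and some string is searched for. [folklore] -/
noncomputable def foundK (K c : List Bool) (k : ℕ) : Option (List Bool) :=
  if k < p₁.eval x.length + 4 ∧ ∃ z, Zs p₁ p₂ Rp cw x K c k z then
    some (uOf (greedy (Zs p₁ p₂ Rp cw x K c k) (Lv p₁ p₂ x)))
  else none

variable {p₁ p₂ Rp cw x}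

/-- Entries of a concatenation of full blocks. [folklore] -/
theorem entriesOf_flatMap {L : ℕ} (hL : 0 < L) (f : ℕ → List Bool) :
    ∀ l : List ℕ, (∀ k ∈ l, (f k).length = L) → entriesOf L (l.flatMap f) = l.map fun k => fstF (f k)
  | [], _ => by simp
  | a :: l, h => by
    have ha : (f a).length = L := h a (by simp)
    rw [List.flatMap_cons, entriesOf_append hL (by rw [ha, Nat.mod_self]), entriesOf_self hL ha,
      entriesOf_flatMap hL f l fun k hk => h k (by simp [hk]), List.map_cons, List.singleton_append]

/-- **The entries after a round**: the old entries, then the entries of the `NB` greedy strings.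
[folklore] -/
theorem entriesOf_nextS (K : St p₁ p₂ x) (c : List Bool) :
    entriesOf (Lv p₁ p₂ x) (nextS p₁ p₂ Rp cw x K c).1 = entriesOf (Lv p₁ p₂ x) K.1 ++
      (List.range (p₁.eval x.length + 4)).map fun k => fstF (greedy (Zs p₁ p₂ Rp cw x K.1 c k) (Lv p₁ p₂ x)) := by
  have hL : 0 < Lv p₁ p₂ x := lt_of_lt_of_le (by norm_num) (two_le_Lv p₁ p₂ x)
  change entriesOf (Lv p₁ p₂ x) (K.1 ++ roundBits p₁ p₂ Rp cw x K.1 c) = _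
  rw [entriesOf_append hL K.2, roundBits, entriesOf_flatMap hL _ _ fun k _ => length_greedy _ _]

/-- A round only shrinks the bad set. [folklore] -/
theorem BdK_nextS_subset (K : St p₁ p₂ x) (c : List Bool) :
    BdK p₁ p₂ Rp cw x (nextS p₁ p₂ Rp cw x K c).1 ⊆ BdK p₁ p₂ Rp cw x K.1 := by
  intro u hu
  rw [mem_BdK] at hu ⊢
  refine ⟨hu.1, bad_mono (fun e he => ?_) hu.2⟩
  rw [entriesOf_nextS]
  exact List.mem_append_left _ he

/-- The greedy string is searched when some string is. [folklore] -/
theorem greedy_mem_Zs {K c : List Bool} {k : ℕ} (h : ∃ z, Zs p₁ p₂ Rp cw x K c k z) :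
    Zs p₁ p₂ Rp cw x K c k (greedy (Zs p₁ p₂ Rp cw x K c k) (Lv p₁ p₂ x)) :=
  greedy_spec h fun _ hz => hz.2.1

variable (hcw : IsCanonWitFn (R₂ Rp) cw) (hRp : ∀ a w, boolPair a w ∈ Rp → w.length ≤ p₂.eval a.length)
include hcw hRp

/-- **The hypotheses of the halving lemma hold for the machine's round**: from every state, one round
multiplies the summed size of the bad set by at most `29/32 · 2^ℓ`. [folklore] -/
theorem hround (K : St p₁ p₂ x) :
    32 * ∑ cv : List.Vector Bool (ellv p₁ x), ((BdK p₁ p₂ Rp cw x (nextS p₁ p₂ Rp cw x K cv.toList).1).card : ℝ) ≤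
      29 * 2 ^ (ellv p₁ x) * (BdK p₁ p₂ Rp cw x K.1).card := by
  have hℓ : (p₁.eval x.length + 1 + 2) * (p₁.eval x.length + 1 + 1) ≤ ellv p₁ x := le_of_eq (by rw [ellv])
  refine round_sum_le (M := p₁.eval x.length + 1) hℓ (BdK p₁ p₂ Rp cw x K.1) (embed (p₁.eval x.length))
    ((embed_injOn (p₁.eval x.length)).mono fun u hu => (mem_BdK.1 (mem_coe.1 hu)).1) (beatR Rp cw x)
    (fun a _ b _ ⟨w₁, hw₁, hb₁⟩ ⟨w₂, hw₂, hb₂⟩ => not_beats_symm hcw hw₂ hw₁ hb₁ hb₂)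
    (fun k cv => foundK p₁ p₂ Rp cw x K.1 cv.toList k) (fun cv => BdK p₁ p₂ Rp cw x (nextS p₁ p₂ Rp cw x K cv.toList).1)
    (fun cv => BdK_nextS_subset K cv.toList) ?_ ?_
  · -- `hfound`
    rintro k hk cv ⟨u, hu, hzero⟩
    have hul := (mem_BdK.1 hu).1
    rw [hash_embed_eq_zero_iff _ hul] at hzero
    obtain ⟨z, hz, -⟩ := zs_complete hRp hu hzero
    have hne : ∃ z, Zs p₁ p₂ Rp cw x K.1 cv.toList k z := ⟨z, hz⟩
    have hg := zs_sound (greedy_mem_Zs hne)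
    refine ⟨_, hg.1, ?_, ?_⟩
    · rw [foundK, if_pos ⟨by omega, hne⟩]
    · rw [hash_embed_eq_zero_iff _ (mem_BdK.1 hg.1).1]; exact hg.2.2.2
  · -- `hbeat`
    intro k cv u' hf u hu
    simp only [foundK] at hf
    split_ifs at hf with h
    obtain ⟨hk, hne⟩ := h
    have hu' : u' = uOf (greedy (Zs p₁ p₂ Rp cw x K.1 cv.toList k) (Lv p₁ p₂ x)) := (Option.some.inj hf).symm
    have hg := zs_sound (greedy_mem_Zs hne)
    set g := greedy (Zs p₁ p₂ Rp cw x K.1 cv.toList k) (Lv p₁ p₂ x)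
    rw [mem_filter]
    refine ⟨BdK_nextS_subset K cv.toList hu, ?_⟩
    have hbad := (mem_BdK.1 hu).2
    have hmem : fstF g ∈ entriesOf (Lv p₁ p₂ x) (nextS p₁ p₂ Rp cw x K cv.toList).1 := by
      rw [entriesOf_nextS]
      exact List.mem_append_right _ (List.mem_map.2 ⟨k, List.mem_range.2 hk, rfl⟩)
    have hb := beats_of_bad hmem hg.2.2.1 hbad
    have hfst : fstP (fstF g) = boolPair x u' := by rw [hu']; exact hg.2.1
    rw [hfst] at hb
    refine ⟨sndP (fstF g), ?_, hb.2⟩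
    have hv : boolPair (fstP (fstF g)) (sndP (fstF g)) ∈ Rp := hg.2.2.1
    rwa [hfst] at hv

omit hcw hRp in
/-- **The advice after `j` rounds is the state after `j` rounds** of the process driven by the coin
blocks. [folklore] -/
theorem foldl_coins_eq_AB (y : List Bool) : ∀ j ≤ Tv p₁ x,
    (((List.range j).map (coinsOf p₁ x y)).foldl (nextS p₁ p₂ Rp cw x) (st0 p₁ p₂ x)).1 =
      AB p₁ p₂ Rp cw x y (j * LRv p₁ p₂ x)
  | 0, _ => by rw [Nat.zero_mul]; rfl
  | j + 1, hj => by
    rw [List.range_succ, List.map_append, List.foldl_append, List.map_singleton, List.foldl_cons, List.foldl_nil]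
    change (_ : List Bool) ++ _ = _
    rw [foldl_coins_eq_AB y j (by omega), AB_round (by omega)]

/-- **The advice is bad with probability at most `1/2`** over the coins `y ∈ {0,1}^{T ℓ}`.
[Köbler–Watanabe 1998 (a `ZPP^NP` computation of correct advice), here by parts II–IV] [folklore] -/
theorem prob_bad_le_half :
    uniformProb ((coinP p₁).eval x.length)
      {y | (BdK p₁ p₂ Rp cw x (AB p₁ p₂ Rp cw x y (NQv p₁ p₂ x))).Nonempty} ≤ 1 / 2 := by
  have h₀ : (BdK p₁ p₂ Rp cw x (st0 p₁ p₂ x).1).card ≤ 2 ^ (p₁.eval x.length + 1) :=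
    (card_filter_le _ _).trans (card_strLe_le _)
  have hT : 8 * (p₁.eval x.length + 1 + 1) ≤ Tv p₁ x := le_of_eq (by simp [Tv])
  have hm : Tv p₁ x * ellv p₁ x ≤ (coinP p₁).eval x.length :=
    le_of_eq (by rw [(eval_params p₁ p₂ x.length).2.2.2.2.2]; simp [Tv, ellv])
  have key := uniformProb_nonempty_le_half (nextS p₁ p₂ Rp cw x) (fun K => BdK p₁ p₂ Rp cw x K.1)
    (hround hcw hRp) (st0 p₁ p₂ x) h₀ hT hm
  have hev : {y : List Bool | (BdK p₁ p₂ Rp cw x (AB p₁ p₂ Rp cw x y (NQv p₁ p₂ x))).Nonempty} =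
      {r | (BdK p₁ p₂ Rp cw x ((blocks (Tv p₁ x) (ellv p₁ x) r).foldl (nextS p₁ p₂ Rp cw x) (st0 p₁ p₂ x)).1).Nonempty} := by
    ext y
    simp only [Set.mem_setOf_eq]
    rw [show blocks (Tv p₁ x) (ellv p₁ x) y = (List.range (Tv p₁ x)).map (coinsOf p₁ x y) from rfl,
      foldl_coins_eq_AB y (Tv p₁ x) le_rfl]
    rfl
  rw [hev]
  exact key

end Halving

/-! ### Zero error and completeness of the two evaluators -/

/-- `χ_A u = 1 ↔ u ∈ A`, for the `Language` membership instance. [folklore] -/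
private theorem boolIndicator_true_iff (A : Language Bool) (u : List Bool) : A.boolIndicator u = true ↔ u ∈ A :=
  (Set.mem_iff_boolIndicator A u).symm

/-- `χ_A u = 0 ↔ u ∉ A`, for the `Language` membership instance. [folklore] -/
private theorem boolIndicator_false_iff (A : Language Bool) (u : List Bool) : A.boolIndicator u = false ↔ u ∉ A :=
  (Set.notMem_iff_boolIndicator A u).symm

section Decide

variable {p₁ p₂ : Polynomial ℕ} {Rp : Language Bool} {cw : List Bool → List Bool} {x : List Bool}
variable (hRp : ∀ a w, boolPair a w ∈ Rp → w.length ≤ p₂.eval a.length)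
include hRp

/-- **What acceptance by `dec 0 1` means**: the advice is good and some short `u` passes the
certificate. [folklore] -/
theorem accept_iff (y : List Bool) :
    boolPair x y ∈ AdQuery.adLang (qgen p₁ p₂) (NQp p₁ p₂ + 2) (dec p₁ p₂ false true) (orc p₁ p₂ Rp cw) ↔
      BdK p₁ p₂ Rp cw x (AB p₁ p₂ Rp cw x y (NQv p₁ p₂ x)) = ∅ ∧
        ∃ u, u.length ≤ p₁.eval x.length ∧
          Cert Rp cw (entriesOf (Lv p₁ p₂ x) (AB p₁ p₂ Rp cw x y (NQv p₁ p₂ x))) (boolPair x u) := by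
  rw [mem_adLang_dec_iff, boolIndicator_false_iff, boolIndicator_true_iff, badQ, decQ,
    badQ_mem_iff hRp, decQ_mem_iff, not_nonempty_iff_eq_empty]

/-- **What acceptance by `dec 0 0` means**: the advice is good and no short `u` passes the
certificate. [folklore] -/
theorem reject_iff (y : List Bool) :
    boolPair x y ∈ AdQuery.adLang (qgen p₁ p₂) (NQp p₁ p₂ + 2) (dec p₁ p₂ false false) (orc p₁ p₂ Rp cw) ↔
      BdK p₁ p₂ Rp cw x (AB p₁ p₂ Rp cw x y (NQv p₁ p₂ x)) = ∅ ∧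
        ¬ ∃ u, u.length ≤ p₁.eval x.length ∧
          Cert Rp cw (entriesOf (Lv p₁ p₂ x) (AB p₁ p₂ Rp cw x y (NQv p₁ p₂ x))) (boolPair x u) := by
  rw [mem_adLang_dec_iff, boolIndicator_false_iff, boolIndicator_false_iff, badQ, decQ,
    badQ_mem_iff hRp, decQ_mem_iff, not_nonempty_iff_eq_empty]

end Decide

/-! ### Probability bookkeeping -/

section Prob

/-- `uniformProb` is monotone (from the definition; cf. `PromiseCookMachine.uniformProb_mono`). [folklore] -/
private theorem uniformProb_mono'' {m : ℕ} {E F : Set (List Bool)} (h : E ⊆ F) : uniformProb m E ≤ uniformProb m F := by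
  unfold uniformProb
  exact div_le_div_of_nonneg_right (by exact_mod_cast card_le_card (fun v hv => by
    rw [mem_filter] at hv ⊢; exact ⟨hv.1, h hv.2⟩)) (by positivity)

/-- An event of probability `< 1` misses some string. [folklore] -/
private theorem exists_not_mem_of_uniformProb_lt_one {m : ℕ} {E : Set (List Bool)} (h : uniformProb m E < 1) :
    ∃ y : List Bool, y.length = m ∧ y ∉ E := by
  by_contra hall
  push Not at hall
  have : uniformProb m E = 1 := by
    unfold uniformProb
    rw [filter_true_of_mem fun v _ => hall v.toList v.toList_length, card_univ, card_vector, Fintype.card_bool]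
    push_cast
    exact div_self (by positivity)
  linarith

end Prob

/-! ### `Σ₂ᵖ ⊆ RP^NP ∩ coRP^NP` and `Π₂ᵖ ⊆ Σ₂ᵖ` under `Ker(FP) ⊆ CF(FP)` -/

section Assembly

/-- `NP` is closed under binary union. [Arora–Barak 2009, §2.1] [folklore] -/
theorem union_mem_NP {L₁ L₂ : Language Bool} (h₁ : L₁ ∈ Nondeterministic.NP) (h₂ : L₂ ∈ Nondeterministic.NP) :
    L₁ ⊔ L₂ ∈ Nondeterministic.NP := by
  obtain ⟨V₁, hV₁, q₁, hq₁⟩ := h₁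
  obtain ⟨V₂, hV₂, q₂, hq₂⟩ := h₂
  refine ⟨(LenLe q₁ ⊓ V₁) ⊔ (LenLe q₂ ⊓ V₂), union_mem_P (inter_mem_P (LenLe_mem_P q₁) hV₁)
    (inter_mem_P (LenLe_mem_P q₂) hV₂), q₁ + q₂, fun x => ?_⟩
  change x ∈ L₁ ∨ x ∈ L₂ ↔ ∃ y, y.length ≤ (q₁ + q₂).eval x.length ∧
    ((boolPair x y ∈ LenLe q₁ ∧ boolPair x y ∈ V₁) ∨ (boolPair x y ∈ LenLe q₂ ∧ boolPair x y ∈ V₂))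
  simp only [boolPair_mem_LenLe, eval_add, hq₁, hq₂]
  constructor
  · rintro (⟨y, hy, hV⟩ | ⟨y, hy, hV⟩)
    · exact ⟨y, by omega, Or.inl ⟨hy, hV⟩⟩
    · exact ⟨y, by omega, Or.inr ⟨hy, hV⟩⟩
  · rintro ⟨y, -, (⟨hy, hV⟩ | ⟨hy, hV⟩)⟩
    · exact Or.inl ⟨y, hy, hV⟩
    · exact Or.inr ⟨y, hy, hV⟩

/-- **The data of a `Σ₂ᵖ` language under `Ker(FP) ⊆ CF(FP)`**: bounds `p₁, p₂`, a verifier `Rp ∈ P`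
with bounded witnesses for the inner `NP` language `N`, a canonical-witness function `cw ∈ FP` for the
pair verifier, and the presentation `x ∈ L ↔ ∃ u, |u| ≤ p₁ n ∧ ⟨x, u⟩ ∉ N`. [folklore] -/
theorem sigmaTwo_data (h : KerFP ⊆ CFFP) {L : Language Bool} (hL : L ∈ SigmaP 2) :
    ∃ (p₁ p₂ : Polynomial ℕ) (Rp : Language Bool) (cw : List Bool → List Bool),
      Rp ∈ Classes.P ∧ cw ∈ FP ∧ IsCanonWitFn (R₂ Rp) cw ∧
      (∀ a w, boolPair a w ∈ Rp → w.length ≤ p₂.eval a.length) ∧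
      ∀ x, x ∈ L ↔ ∃ u, u.length ≤ p₁.eval x.length ∧ ¬ HasWit Rp (boolPair x u) := by
  obtain ⟨L₁, hL₁, p₁, hp₁⟩ := (show L ∈ polyExists (co (SigmaP 1)) from hL)
  obtain ⟨R, hRco, p₂, hp₂⟩ := (show L₁ᶜ ∈ polyExists (co Classes.P) from hL₁)
  have hR : R ∈ Classes.P := compl_mem_P_iff.1 hRco
  have hRpP : Rbound R p₂ ∈ Classes.P := Rbound_mem_P hR p₂
  obtain ⟨cw, hcwFP, hcw⟩ := exists_isCanonWitFn h (R₂_mem_P hRpP)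
  refine ⟨p₁, p₂, Rbound R p₂, cw, hRpP, hcwFP, hcw, fun a w hw => ((boolPair_mem_Rbound R p₂ a w).1 hw).1,
    fun x => ?_⟩
  rw [hp₁ x]
  simp only [hasWit_Rbound_iff hp₂]
  exact exists_congr fun u => and_congr Iff.rfl (show boolPair x u ∈ L₁ ↔ ¬ boolPair x u ∉ L₁ from not_not.symm)

/-- **`Σ₂ᵖ ⊆ RP^NP ∩ coRP^NP` if `Ker(FP) ⊆ CF(FP)`**: run the advice construction; on good advice
(probability `≥ 1/2`) the decision query answers the `Σ₂` question, and an accepted run is always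
right (zero error) since acceptance includes the bad test. [cite: FortnowGrochow2011, Cor. 3.4] -/
theorem SigmaP_two_subset_Z (h : KerFP ⊆ CFFP) :
    SigmaP 2 ⊆ rp (PRelClass Nondeterministic.NP) ∩ co (rp (PRelClass Nondeterministic.NP)) := by
  intro L hL
  obtain ⟨p₁, p₂, Rp, cw, hRpP, hcwFP, hcw, hRp, hxL⟩ := sigmaTwo_data h hL
  have hmem : ∀ b, AdQuery.adLang (qgen p₁ p₂) (NQp p₁ p₂ + 2) (dec p₁ p₂ false b) (orc p₁ p₂ Rp cw) ∈
      PRelClass Nondeterministic.NP :=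
    fun b => AdQuery.adLang_mem_PRelClass (qgen_mem_FP p₁ p₂) (dec_mem_P p₁ p₂ false b) (orc_mem_NP p₁ p₂ Rp cw hRpP hcwFP)
  -- on good advice both evaluators are right, and good advice has probability `≥ 1/2`
  have hgood : ∀ x, 1 / 2 ≤ uniformProb ((coinP p₁).eval x.length)
      {y | BdK p₁ p₂ Rp cw x (AB p₁ p₂ Rp cw x y (NQv p₁ p₂ x)) = ∅} := by
    intro x
    have hc : {y : List Bool | BdK p₁ p₂ Rp cw x (AB p₁ p₂ Rp cw x y (NQv p₁ p₂ x)) = ∅} =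
        {y | (BdK p₁ p₂ Rp cw x (AB p₁ p₂ Rp cw x y (NQv p₁ p₂ x))).Nonempty}ᶜ := by
      ext y; simp only [Set.mem_setOf_eq, Set.mem_compl_iff, not_nonempty_iff_eq_empty]
    rw [hc, uniformProb_compl]
    have := prob_bad_le_half (p₁ := p₁) (p₂ := p₂) (x := x) hcw hRp
    linarith
  constructor
  · refine ⟨_, hmem true, coinP p₁, fun x => ⟨fun hx => ?_, fun hx y _ hy => hx ?_⟩⟩
    · refine (hgood x).trans (uniformProb_mono'' fun y hy => ?_)
      rw [Set.mem_setOf_eq] at hy ⊢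
      exact (accept_iff hRp y).2 ⟨hy, (good_decision hcw hy).2 ((hxL x).1 hx)⟩
    · obtain ⟨hK, hc⟩ := (accept_iff hRp y).1 hy
      exact (hxL x).2 ((good_decision hcw hK).1 hc)
  · refine ⟨_, hmem false, coinP p₁, fun x => ⟨fun hx => ?_, fun hx y _ hy => hx ?_⟩⟩
    · refine (hgood x).trans (uniformProb_mono'' fun y hy => ?_)
      rw [Set.mem_setOf_eq] at hy ⊢
      refine (reject_iff hRp y).2 ⟨hy, fun hc => hx ((hxL x).2 ((good_decision hcw hy).1 hc))⟩
    · obtain ⟨hK, hc⟩ := (reject_iff hRp y).1 hy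
      intro hxL'
      exact hc ((good_decision hcw hK).2 ((hxL x).1 hxL'))

/-- The bad-test query as a function of `⟨x, K⟩` (no coins, level `0`, no prefix). [folklore] -/
noncomputable def badF : List Bool → List Bool :=
  pairFn (fun _ => [false]) (pairFn fstP (pairFn sndP (fun _ => boolPair [] (boolPair [] []))))

/-- The decision query as a function of `⟨x, K⟩`. [folklore] -/
noncomputable def decF : List Bool → List Bool :=
  pairFn (fun _ => [true]) (pairFn fstP (pairFn sndP (fun _ => boolPair [] (boolPair [] []))))

/-- `badF`, `decF ∈ FP`. [folklore] -/
theorem badF_decF_mem_FP : badF ∈ FP ∧ decF ∈ FP :=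
  ⟨pairFn_mem_FP (const_mem_FP _) (pairFn_mem_FP fstP_mem_FP (pairFn_mem_FP sndP_mem_FP (const_mem_FP _))),
    pairFn_mem_FP (const_mem_FP _) (pairFn_mem_FP fstP_mem_FP (pairFn_mem_FP sndP_mem_FP (const_mem_FP _)))⟩

/-- Values of `badF`, `decF`. [folklore] -/
theorem badF_decF_boolPair (x K : List Bool) :
    badF (boolPair x K) = mkQ false x K [] 0 [] ∧ decF (boolPair x K) = mkQ true x K [] 0 [] := by
  simp [badF, decF, mkQ]

/-- **`Π₂ᵖ ⊆ Σ₂ᵖ` if `Ker(FP) ⊆ CF(FP)`** (the collapse of Hemaspaandra–Naik–Ogihara–Selman, here from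
the advice directly): `x ∈ L` iff some advice string `K` passes the bad test and fails the decision
query for `Lᶜ` — a `coNP` matrix; a good `K` exists since the construction succeeds with positive
probability. [cite: FortnowGrochow2011, Cor. 3.4] -/
theorem PiP_two_subset_SigmaP_two' (h : KerFP ⊆ CFFP) : PiP 2 ⊆ SigmaP 2 := by
  intro L hL
  obtain ⟨p₁, p₂, Rp, cw, hRpP, hcwFP, hcw, hRp, hxL⟩ := sigmaTwo_data h (show Lᶜ ∈ SigmaP 2 from hL)
  -- the matrix: the bad test fails and the decision query fails
  set ML : Language Bool := (badF ⁻¹' orc p₁ p₂ Rp cw ⊔ decF ⁻¹' orc p₁ p₂ Rp cw)ᶜ with hML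
  have horc : orc p₁ p₂ Rp cw ∈ Nondeterministic.NP := orc_mem_NP p₁ p₂ Rp cw hRpP hcwFP
  have hMLco : ML ∈ co (SigmaP 1) := by
    change MLᶜ ∈ SigmaP 1
    rw [hML, compl_compl, SigmaP_one_holds]
    exact union_mem_NP (preimage_mem_NP horc badF_decF_mem_FP.1) (preimage_mem_NP horc badF_decF_mem_FP.2)
  have hMLiff : ∀ x K, boolPair x K ∈ ML ↔
      ¬ (BdK p₁ p₂ Rp cw x K).Nonempty ∧
        ¬ ∃ u, u.length ≤ p₁.eval x.length ∧ Cert Rp cw (entriesOf (Lv p₁ p₂ x) K) (boolPair x u) := by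
    intro x K
    rw [hML]
    change ¬ (badF (boolPair x K) ∈ orc p₁ p₂ Rp cw ∨ decF (boolPair x K) ∈ orc p₁ p₂ Rp cw) ↔ _
    rw [(badF_decF_boolPair x K).1, (badF_decF_boolPair x K).2, badQ_mem_iff hRp, decQ_mem_iff, not_or]
  refine ⟨ML, hMLco, NQp p₁ p₂, fun x => ⟨fun hx => ?_, ?_⟩⟩
  · -- a good advice exists: the construction fails with probability `≤ 1/2 < 1`
    obtain ⟨y, -, hy⟩ := exists_not_mem_of_uniformProb_lt_one
      (lt_of_le_of_lt (prob_bad_le_half (p₁ := p₁) (p₂ := p₂) (x := x) hcw hRp) (by norm_num))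
    rw [Set.mem_setOf_eq, not_nonempty_iff_eq_empty] at hy
    refine ⟨AB p₁ p₂ Rp cw x y (NQv p₁ p₂ x), by rw [length_AB, eval_NQp], (hMLiff x _).2 ⟨?_, fun hc => ?_⟩⟩
    · rw [not_nonempty_iff_eq_empty]; exact hy
    · exact ((hxL x).2 ((good_decision hcw hy).1 hc)) hx
  · rintro ⟨K, -, hK⟩
    obtain ⟨hne, hc⟩ := (hMLiff x K).1 hK
    rw [not_nonempty_iff_eq_empty] at hne
    by_contra hx
    exact hc ((good_decision hcw hne).2 ((hxL x).1 hx))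

end Assembly

end CFKer

/-- **Discharge of `blassGurevich_CF_eq_Ker_PH`** (Fortnow–Grochow 2011, Cor. 3.4: "If `CF = Ker` then
`PH = ZPP^NP`"): under `Ker(FP) ⊆ CF(FP)`, `Σ₂ᵖ ⊆ RP^NP ∩ coRP^NP` (`CFKer.SigmaP_two_subset_Z`) and
`Π₂ᵖ ⊆ Σ₂ᵖ` (`CFKer.PiP_two_subset_SigmaP_two'`), so `PH = Σ₂ᵖ`
(`KarpLipton.PH_eq_SigmaP_two_of_PiP_two_subset`) lies in `rp (P^NP) ∩ co (rp (P^NP))`.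
[cite: FortnowGrochow2011, Cor. 3.4] -/
theorem blassGurevich_CF_eq_Ker_PH_holds : blassGurevich_CF_eq_Ker_PH := by
  intro h
  rw [KarpLipton.PH_eq_SigmaP_two_of_PiP_two_subset (CFKer.PiP_two_subset_SigmaP_two' h)]
  exact CFKer.SigmaP_two_subset_Z h

end Literature.Computability.Complexity
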